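import Literature.NumberTheory.EllipticCurves.ThreeTorsionReducibleInertiaShapeKodairaThreeProofs
import Literature.NumberTheory.EllipticCurves.FormalGroupChart
import Literature.NumberTheory.EllipticCurves.SupersingularInertiaShapeExponentProofs
import Literature.NumberTheory.EllipticCurves.OpenImageMazurAssemblyProofs
import Literature.NumberTheory.GaloisRepresentations.SerreWeightLevelTwoEvaluationProofs
import HarnessLib

/-!
# `E[3]` irreducible over `ℚ₃` on the Kodaira type III / III* rows: Serre's additive embedding on
# the quartic twist, the level-two inertia shapes `diag(ψ₂⁷, ψ₂⁵)` / `diag(ψ₂³, ψ₂)`, and Serre's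
# weights `6` / `2` at every local restriction datum

Companion of `ThreeTorsionReducibleInertiaShapeKodairaThreeProofs` (the case "`E[3]` reducible over
`loc.F`": wild, level one).  Here we treat the complementary case "`E[3]` IRREDUCIBLE over `loc.F`"
(Conrad–Diamond–Taylor, proof of Thm. 7.2.1, p. 553: "`ρ̄|G₃ ≅ E[3](ℚ̄₃)` irreducible, `ρ̄|I₃` tame
of level `2`") and assemble the UNCONDITIONAL statements

* `serreWeight_three_eq_six_of_kodairaSymbolAt_III`: for `E/ℚ` elliptic with Kodaira type III at
  the place over `3`, every framing `ρ̄` of `E[3]`, every `j : 𝔽₃ → k` (discrete field), EVERY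
  local restriction datum `loc` of `ρ̄ ⊗_j k` at `3` and every residue embedding `ι`:
  `serreWeight 3 (ρ̄ ⊗ k) loc ι = 6`;
* `serreWeight_three_eq_two_of_kodairaSymbolAt_IIIstar`: the same with type III* and weight `2`.

## The argument (Serre 1972 §1.9–§1.11 carried out on the quartic twist)

Let `F` be a `3`-adic field with uniformiser `3` and residue field `𝔽₃`, `q = ‖3‖ < 1` the absolute
value on `F̄`, `E = V/F` a Tate normal form of type III (`‖aᵢ‖ ≤ q` for `i ≤ 4`, `‖a₆‖ ≤ q²`,
`‖Δ‖ = q³`; type III*: `‖a₁‖ ≤ q`, `‖a₂‖ ≤ q²`, `‖a₃‖, ‖a₄‖ ≤ q³`, `‖a₆‖ ≤ q⁵`, `‖Δ‖ = q⁹`).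

* §1–§3 (Newton polygon of `Ψ₃ = 3x⁴ + b₂x³ + 3b₄x² + 3b₆x + b₈`).  On type III one has
  `‖b₂‖ ≤ q`, `‖b₄‖ = q`, `‖b₆‖ ≤ q²`, `‖b₈‖ = q²` (reducible file).  If `‖b₂‖ = q` the polygon
  has a side of length one, `Ψ₃` has a unique root of norm `1`, which is `Γ_F`-invariant hence
  `F`-rational, and `E[3]` is reducible (`not_hasIrreducibleModPGaloisRep_three_of_algNorm_b₂_eq_III`,
  via `ModThreeReducibleIffPsi3Root`).  So irreducibility forces `‖b₂‖ ≤ q²` (as `‖b₂‖ ∈ q^ℤ`),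
  the polygon is a single side of slope `-1/4`, every root has `‖x‖⁴ = q`
  (`algNorm_root_Ψ₃_pow_four_III`), `‖Ψ₂²(x)‖⁴ = q³` (`algNorm_eval_Ψ₂Sq_pow_four_III`) and every
  `T = (x, y) ∈ E[3] ∖ 0` has `‖y‖⁸ = q³` (`algNorm_y_pow_eight_eq`).  Type III*: `‖b₂‖ ≤ q³`,
  `‖x‖⁴ = q⁵`, `‖y‖⁸ = q¹⁵`.
* §4 (`exists_additive_equivariant_of_torsion_norms`, both types at once, parameter `k = 1, 3`).
  With `π⁸ = 3` the Kummer root defining `ψ₂` and `u = π^{2k}`, the model `E' = ⟨u, 0, 0, 0⟩ • E_{F̄}`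
  is integral for `w = ‖·‖` and `E[3]` lies in the kernel of reduction of `E'` with parameter
  `z' = u z`, `z = -x/y`, `‖z'‖ = ‖π‖`.  Serre's map `θ(T) = ι(z'(T)/π mod 𝔓)` is additive on
  `E[3]` by the first-order additivity of `z'` on the formal group
  (`FormalGroupChart.val_zCoord_add_sub_le`), injective, and inertia acts through
  `z(σT)/z(T) ≡ ψ₂(σ)^{-(2k-1)}` (`‖z⁻¹‖ = ‖π^{2k-1}‖`, `residue_smul_div_eq_of_algNorm_eq`,
  Serre's §1.7 Prop. 3): `ψ₂(σ)^{2k-1} θ(σT) = θ(T)`.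
* §5.  `θ³` is then additive, injective and `ψ₂⁵`- (III) resp. `ψ₂`- (III*) equivariant
  (`ψ₂⁸ = 1`), and the local representation-theoretic lemma §R
  (`hasLevelTwoInertiaShape_of_additive_equivariant_exponent_local`, the arbitrary-`F` form of the
  tree's `K_v`-version in `SupersingularInertiaShapeExponentProofs`) gives the level-two shapes
  `(a, b) = (1, 2)` resp. `(0, 1)`; Serre's recipe (`serreWeight_eq_of_hasLevelTwoInertiaShape`,
  Serre 1987 (2.2.4)) gives `k = 1 + 3a + b = 6` resp. `2`.
* §6.  Over `ℚ`: the rational Tate normal forms `exists_variableChange_tateNormalForm_III/IIIstar`,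
  transport of the framing (`isTorsionGaloisRep_variableChange'`) and of irreducibility
  (`Mazur1978.hasIrreducibleModPGaloisRep_smul_iff`), the valuation-to-norm bridge
  (`algNorm_le_pow_of_valuation_le`), and the case split with the reducible file.

These are the Literature-side inputs for the tame-quartic Manin-parity route's items
`TprimeIrrKodairaThreeSerreWeightSix` / `TprimeIrrKodairaThreeStarSerreWeightTwo` (which add the
bridge from `v₃(Δ_min) ∈ {3, 9}` on the `(t′)` class to the Kodaira symbol); nothing here bears on
the truth of BSD itself.

## References

* J.-P. Serre, *Propriétés galoisiennes des points d'ordre fini des courbes elliptiques*, Invent.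
  Math. 15 (1972), §1.7 Prop. 3, §1.9 Prop. 9, §1.10 Prop. 10, §1.11 Prop. 12. [SerreInventiones1972]
* J.-P. Serre, *Sur les représentations modulaires de degré 2 de Gal(ℚ̄/ℚ)*, Duke Math. J. 54
  (1987), §2.2 (2.2.4). [Serre1987]
* B. Conrad, F. Diamond, R. Taylor, *Modularity of certain potentially Barsotti–Tate Galois
  representations*, J. Amer. Math. Soc. 12 (1999), Conj. 1.2.3 (p. 525), §7.2 proof of Thm. 7.2.1
  (p. 553). [ConradDiamondTaylor1999]
* J. H. Silverman, *The Arithmetic of Elliptic Curves*, 2nd ed. (2009), III.2.3, III Ex. 3.7, IV.1,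
  VII.2.2. [SilvermanAEC2009]
* J. H. Silverman, *Advanced Topics in the Arithmetic of Elliptic Curves* (1994), IV.9.4 (Tate's
  algorithm, Steps 4 and 9, Table 4.1). [SilvermanATAEC1994]
* J. Neukirch, *Algebraic Number Theory* (1999), Ch. II (4.8), (6.3)–(6.4). [NeukirchANT1999]
* J. E. Cremona, *Algorithms for Modular Elliptic Curves*, 2nd ed. (1997), §3.8. [Cremona1997]
-/

noncomputable section

open scoped Classical NNReal
open Field Polynomial ValuativeRel

universe u v

/-! ## §R. The representation-theoretic half over an arbitrary `p`-adic field -/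

namespace Literature.NumberTheory.EllipticCurves

open _root_.WeierstrassCurve Literature.NumberTheory.GaloisRepresentations Field
  Literature.NumberTheory.GaloisRepresentations.IsNonarchimedeanLocalField
  Literature.NumberTheory.GaloisRepresentations.ModPGaloisRep ValuativeRel


set_option maxHeartbeats 400000 in
/-- **From a `ψ₂^m`-equivariant additive embedding to the level-two inertia shape `(a, b)` — local
form.**  Let `F` be a `p`-adic field, `E = V/F` elliptic, `ρ̄` a framing of `E[p]` (as a
`Γ_F`-module), `j : 𝔽_p → k`, `ϖ` a uniformiser of `F` with `#k_F = p`, `ι` a residue embedding, and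
`θ : E(F̄) → k` additive and injective on `E[p]` with `θ(σ X) = ψ₂(σ)^m θ(X)` for `σ` in the inertia
group.  If `ψ₂(σ)^{m p} = ψ₂(σ)^{a + p b}` and `ψ₂(σ)^m = ψ₂(σ)^{p a + b}` for all `σ`, then
`ρ̄ ⊗_j k` has `HasLevelTwoInertiaShape ι ϖ hϖ a b`: in the frame `X₀, X₁` of `E[p]` the
`k`-semilinear identity `θ(e⁻¹ w) = j(w₀) r₀ + j(w₁) r₁` and its Frobenius twist
`θ^p` express `ρ̄(σ)` through `diag(ψ₂^{pa+b}, ψ₂^{a+pb})` conjugated by the invertible matrix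
`(r₀ r₁; r₀^p r₁^p)` (`r₀ r₁^p ≠ r₁ r₀^p` since `θ` is injective and `r₀, r₁` are
`𝔽_p`-independent).  This is the tree's
`hasLevelTwoInertiaShape_of_additive_equivariant_exponent` (stated there for the completion `K_v`
of a number field) verbatim over an arbitrary local field `F`, which is what a general local
restriction datum `loc` requires; Serre's `V_e ≅ 𝔪_e/𝔪_e⁺` argument.
[cite: SerreInventiones1972, §1.10 Prop. 10, §1.11 Prop. 12] [cite: Serre1987, §2.2 (2.2.4)] -/
theorem _root_.WeierstrassCurve.IsTorsionGaloisRep.hasLevelTwoInertiaShape_of_additive_equivariant_exponent_local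
    {F : Type u} [Field F] [ValuativeRel F] [TopologicalSpace F] [IsNonarchimedeanLocalField F]
    {V : WeierstrassCurve F} {p : ℕ} [hp : Fact p.Prime]
    {ρ : ModPGaloisRep F (ZMod p) 2} (hρ : V.IsTorsionGaloisRep p ρ)
    {k : Type} [Field k] [TopologicalSpace k] (j : ZMod p →+* k) (hj : Continuous j)
    {ϖ : 𝒪[F]} (hϖ : Irreducible ϖ)
    (ι : absIntegers 𝒪[F] F ⧸ absMaximalIdeal F →+* k)
    (hq : residueFieldCard F = p)
    (θ : geomPoints V → k) (m a b : ℕ)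
    (hθadd : ∀ X ∈ geomTorsion V p, ∀ Y ∈ geomTorsion V p, θ (X + Y) = θ X + θ Y)
    (hθinj : ∀ X ∈ geomTorsion V p, θ X = 0 → X = 0)
    (hθsmul : ∀ (σ : absInertia F), ∀ X ∈ geomTorsion V p,
      θ ((σ : absoluteGaloisGroup F) • X) = (fundamentalCharacter F 2 ι ϖ hϖ σ : k) ^ m * θ X)
    (hexp₀ : ∀ σ : absInertia F,
      (fundamentalCharacter F 2 ι ϖ hϖ σ : k) ^ (m * p) = (fundamentalCharacter F 2 ι ϖ hϖ σ : k) ^ (a + p * b))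
    (hexp₁ : ∀ σ : absInertia F,
      (fundamentalCharacter F 2 ι ϖ hϖ σ : k) ^ m = (fundamentalCharacter F 2 ι ϖ hϖ σ : k) ^ (p * a + b)) :
    ModPGaloisRep.HasLevelTwoInertiaShape (FramedRep.baseChange j hj ρ : ModPGaloisRep F k 2) ι ϖ hϖ a b := by
  classical
  haveI hchark : CharP k p := charP_of_injective_ringHom j.injective p
  haveI : ExpChar k p := ExpChar.prime hp.out
  have hθ0 : θ 0 = 0 := by
    have h := hθadd 0 (zero_mem _) 0 (zero_mem _)
    rw [add_zero] at h
    linear_combination -h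
  -- `ℕ`-linearity
  have hθnsmul : ∀ (n : ℕ), ∀ X ∈ geomTorsion V p, θ (n • X) = (n : k) * θ X := by
    intro n X hXt
    induction n with
    | zero => rw [zero_nsmul, hθ0, Nat.cast_zero, zero_mul]
    | succ n ih =>
      rw [succ_nsmul, hθadd _ (AddSubgroup.nsmul_mem _ hXt n) _ hXt, ih, Nat.cast_succ]
      ring
  -- the frame `X_c = e⁻¹(e_c)`, `r c = θ(X_c)`
  obtain ⟨e, he⟩ := id hρ
  let r : Fin 2 → k := fun c ↦ θ ((e.symm (Pi.single c 1) : geomTorsion V p) : geomPoints V)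
  have hrdef : ∀ c, r c = θ ((e.symm (Pi.single c 1) : geomTorsion V p) : geomPoints V) :=
    fun c ↦ rfl
  have hcast : ∀ a : ZMod p, (((a.val : ℕ) : k)) = j a := fun a ↦ by
    rw [← map_natCast j, ZMod.natCast_zmod_val]
  -- `θ(e⁻¹ vv) = j(vv 0) r 0 + j(vv 1) r 1`
  have hlin : ∀ vv : Fin 2 → ZMod p,
      θ ((e.symm vv : geomTorsion V p) : geomPoints V) = j (vv 0) * r 0 + j (vv 1) * r 1 := by
    intro vv
    have hvv : vv = (vv 0).val • Pi.single (0 : Fin 2) (1 : ZMod p) +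
        (vv 1).val • Pi.single (1 : Fin 2) (1 : ZMod p) := by
      ext i
      fin_cases i
      · show vv 0 = (vv 0).val • (Pi.single (0 : Fin 2) (1 : ZMod p) : Fin 2 → ZMod p) 0 +
          (vv 1).val • (Pi.single (1 : Fin 2) (1 : ZMod p) : Fin 2 → ZMod p) 0
        rw [Pi.single_eq_same, Pi.single_eq_of_ne (by decide), smul_zero, add_zero, nsmul_eq_mul,
          mul_one, ZMod.natCast_zmod_val]
      · show vv 1 = (vv 0).val • (Pi.single (0 : Fin 2) (1 : ZMod p) : Fin 2 → ZMod p) 1 +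
          (vv 1).val • (Pi.single (1 : Fin 2) (1 : ZMod p) : Fin 2 → ZMod p) 1
        rw [Pi.single_eq_same, Pi.single_eq_of_ne (by decide), smul_zero, zero_add, nsmul_eq_mul,
          mul_one, ZMod.natCast_zmod_val]
    have h1 : ((e.symm vv : geomTorsion V p) : geomPoints V) =
        (vv 0).val • ((e.symm (Pi.single 0 1) : geomTorsion V p) : geomPoints V) +
          (vv 1).val • ((e.symm (Pi.single 1 1) : geomTorsion V p) : geomPoints V) := by
      conv_lhs => rw [hvv]
      rw [e.symm.map_add, map_nsmul e.symm, map_nsmul e.symm, AddSubgroup.coe_add,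
        AddSubgroup.coe_nsmul, AddSubgroup.coe_nsmul]
    rw [h1, hθadd _ (AddSubgroup.nsmul_mem _ (e.symm (Pi.single 0 1)).2 _) _
      (AddSubgroup.nsmul_mem _ (e.symm (Pi.single 1 1)).2 _),
      hθnsmul _ _ (e.symm (Pi.single 0 1)).2, hθnsmul _ _ (e.symm (Pi.single 1 1)).2, hcast, hcast]
  -- `𝔽_p`-independence of `r 0, r 1`
  have hind : ∀ a b : ZMod p, j a * r 0 + j b * r 1 = 0 → a = 0 ∧ b = 0 := by
    intro a b hab
    have h1 : θ ((e.symm ![a, b] : geomTorsion V p) : geomPoints V) = 0 := by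
      rw [hlin]; exact hab
    have h2 : ((e.symm ![a, b] : geomTorsion V p) : geomPoints V) = 0 :=
      hθinj _ (e.symm ![a, b]).2 h1
    have h3 : (e.symm ![a, b] : geomTorsion V p) = 0 := Subtype.ext h2
    have h4 : (![a, b] : Fin 2 → ZMod p) = 0 := by
      have := congrArg e h3
      rwa [AddEquiv.apply_symm_apply, e.map_zero] at this
    exact ⟨by simpa using congrFun h4 0, by simpa using congrFun h4 1⟩
  -- row identity (A): `Σ_i j(M i c) r i = ψ(σ)^m r c`
  have hrowA : ∀ (σ : absInertia F) (c : Fin 2),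
      j (((ρ (σ : absoluteGaloisGroup F) : GL (Fin 2) (ZMod p)) : Matrix (Fin 2) (Fin 2) (ZMod p)) 0 c) * r 0 +
        j (((ρ (σ : absoluteGaloisGroup F) : GL (Fin 2) (ZMod p)) : Matrix (Fin 2) (Fin 2) (ZMod p)) 1 c) * r 1 =
        (fundamentalCharacter F 2 ι ϖ hϖ σ : k) ^ m * r c := by
    intro σ c
    set g : absoluteGaloisGroup F := (σ : absoluteGaloisGroup F) with hg
    set M : Matrix (Fin 2) (Fin 2) (ZMod p) :=
      ((ρ g : GL (Fin 2) (ZMod p)) : Matrix (Fin 2) (Fin 2) (ZMod p)) with hM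
    have hcol : M.mulVec (Pi.single c 1) = fun i ↦ M i c := by
      ext i; rw [Matrix.mulVec_single_one]; rfl
    have hsymm : (e.symm (fun i ↦ M i c) : geomTorsion V p) = g • e.symm (Pi.single c 1) := by
      rw [AddEquiv.symm_apply_eq, he g, AddEquiv.apply_symm_apply, ← hM, hcol]
    have h1 := hlin (fun i ↦ M i c)
    rw [hsymm, AddSubgroup.torsionBy.coe_smul, hθsmul σ _ (e.symm (Pi.single c 1)).2] at h1
    rw [← hrdef] at h1
    exact h1.symm
  -- row identity (B): Frobenius of (A)
  have hfrobj : ∀ n : ZMod p, j n ^ p = j n := fun n ↦ by rw [← map_pow, ZMod.pow_card]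
  have hrowB : ∀ (σ : absInertia F) (c : Fin 2),
      j (((ρ (σ : absoluteGaloisGroup F) : GL (Fin 2) (ZMod p)) : Matrix (Fin 2) (Fin 2) (ZMod p)) 0 c) * r 0 ^ p +
        j (((ρ (σ : absoluteGaloisGroup F) : GL (Fin 2) (ZMod p)) : Matrix (Fin 2) (Fin 2) (ZMod p)) 1 c) * r 1 ^ p =
        (fundamentalCharacter F 2 ι ϖ hϖ σ : k) ^ (m * p) * r c ^ p := by
    intro σ c
    rw [pow_mul, ← mul_pow, ← hrowA σ c, add_pow_char, mul_pow, mul_pow, hfrobj, hfrobj]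
  -- the change of basis `P = (r₀^p r₁^p; r₀ r₁)`
  set Pm : Matrix (Fin 2) (Fin 2) k := !![r 0 ^ p, r 1 ^ p; r 0, r 1] with hPm
  have hdet : Pm.det ≠ 0 := by
    rw [hPm, Matrix.det_fin_two_of]
    exact pow_mul_sub_ne_zero_of_forall_eq_zero p j hind
  refine ⟨Matrix.GeneralLinearGroup.mkOfDetNeZero Pm hdet, fun σ ↦ ?_⟩
  set ψ : k := (fundamentalCharacter F 2 ι ϖ hϖ σ : k) with hψ
  set M : Matrix (Fin 2) (Fin 2) (ZMod p) :=
    ((ρ (σ : absoluteGaloisGroup F) : GL (Fin 2) (ZMod p)) : Matrix (Fin 2) (Fin 2) (ZMod p)) with hM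
  -- the base-changed representation at `σ` is `M.map j`
  have hloc : (((FramedRep.baseChange j hj ρ : ModPGaloisRep F k 2) (σ : absoluteGaloisGroup F) : GL (Fin 2) k) :
      Matrix (Fin 2) (Fin 2) k) = M.map j := by
    rw [FramedRep.coe_baseChange_apply]
  -- `Pm (M.map j) = diag(ψ^{a+pb}, ψ^{pa+b}) Pm`
  have hkey : Pm * M.map j = !![ψ ^ (a + p * b), 0; 0, ψ ^ (p * a + b)] * Pm := by
    rw [← hexp₀ σ, ← hexp₁ σ]
    ext i c
    rw [Matrix.mul_apply, Matrix.mul_apply, Fin.sum_univ_two, Fin.sum_univ_two, Matrix.map_apply,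
      Matrix.map_apply]
    have hA' := hrowA σ c
    have hB' := hrowB σ c
    rw [← hM, ← hψ] at hA' hB'
    fin_cases i <;> fin_cases c <;>
      simp only [hPm, Matrix.of_apply, Matrix.cons_val', Matrix.cons_val_zero, Matrix.cons_val_one,
        Matrix.cons_val_fin_one, Matrix.empty_val', Fin.isValue, Fin.zero_eta, Fin.mk_one] at hA' hB' ⊢ <;>
      first | linear_combination hB' | linear_combination hA'
  -- conclusion
  have hPP : Pm * ((((Matrix.GeneralLinearGroup.mkOfDetNeZero Pm hdet)⁻¹ : GL (Fin 2) k)) :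
      Matrix (Fin 2) (Fin 2) k) = 1 :=
    Units.mul_inv (Matrix.GeneralLinearGroup.mkOfDetNeZero Pm hdet)
  rw [Matrix.GeneralLinearGroup.coe_mul, Matrix.GeneralLinearGroup.coe_mul, hloc]
  change Pm * M.map j * _ = _
  rw [hkey, mul_assoc, hPP, mul_one, hψ]
  simp only [Units.val_pow_eq_pow_val, hq]

end Literature.NumberTheory.EllipticCurves

/-! ## §0. Ultrametric helpers -/

namespace Literature.NumberTheory.EllipticCurves.ThreeTorsionIrreducibleShape

open Literature.NumberTheory.GaloisRepresentations
  Literature.NumberTheory.GaloisRepresentations.IsNonarchimedeanLocalField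
  Literature.NumberTheory.EllipticCurves.ThreeTorsionReducibleShape

variable {F : Type u} [Field F] [ValuativeRel F] [TopologicalSpace F] [IsNonarchimedeanLocalField F]

/-- `‖a + b‖ < c` if `‖a‖, ‖b‖ < c`. [folklore] -/
private theorem algNorm_add_lt {a b : AlgebraicClosure F} {c : ℝ} (ha : algNorm F a < c)
    (hb : algNorm F b < c) : algNorm F (a + b) < c :=
  lt_of_le_of_lt (algNorm_add_le a b) (max_lt ha hb)

/-- `‖a + b‖ ≤ c` if `‖a‖, ‖b‖ ≤ c`. [folklore] -/
private theorem algNorm_add_le_of_le {a b : AlgebraicClosure F} {c : ℝ} (ha : algNorm F a ≤ c)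
    (hb : algNorm F b ≤ c) : algNorm F (a + b) ≤ c :=
  (algNorm_add_le a b).trans (max_le ha hb)

/-- `‖a - b‖ < c` if `‖a‖, ‖b‖ < c`. [folklore] -/
private theorem algNorm_sub_lt {a b : AlgebraicClosure F} {c : ℝ} (ha : algNorm F a < c)
    (hb : algNorm F b < c) : algNorm F (a - b) < c :=
  lt_of_le_of_lt (algNorm_sub_le a b) (max_lt ha hb)

/-- A sum with a strictly dominant term is non-zero: `‖b‖ < ‖a‖ ⇒ a + b ≠ 0`. [folklore] -/
private theorem add_ne_zero_of_algNorm_lt {a b : AlgebraicClosure F} (h : algNorm F b < algNorm F a) :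
    a + b ≠ 0 := by
  intro h0
  have h1 : algNorm F (a + b) = algNorm F a := algNorm_add_eq_left h
  rw [h0, algNorm_zero] at h1
  have : 0 < algNorm F a := lt_of_le_of_lt (algNorm_nonneg _) h
  exact this.ne h1

/-- If `‖a - b‖ < 1`, `‖b‖ = 1` then `‖a‖ = 1` (for `‖a‖ ≤ 1`). [folklore] -/
private theorem algNorm_eq_one_of_algNorm_sub_lt {a b : AlgebraicClosure F} (ha : algNorm F a ≤ 1)
    (hb : algNorm F b = 1) (h : algNorm F (a - b) < 1) : algNorm F a = 1 := by
  by_contra hne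
  have hlt : algNorm F a < 1 := lt_of_le_of_ne ha hne
  have h1 : algNorm F (a - (a - b)) < 1 := algNorm_sub_lt hlt h
  rw [sub_sub_cancel, hb] at h1
  exact lt_irrefl _ h1

/-- `‖s.sum‖ < c` if every `‖x‖ < c` for `x ∈ s` (and `0 < c`). [folklore] -/
private theorem algNorm_multiset_sum_lt {s : Multiset (AlgebraicClosure F)} {c : ℝ} (hc : 0 < c)
    (h : ∀ x ∈ s, algNorm F x < c) : algNorm F s.sum < c := by
  induction s using Multiset.induction_on with
  | empty => simpa using hc
  | cons a s ih =>
    rw [Multiset.sum_cons]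
    exact algNorm_add_lt (h a (Multiset.mem_cons_self a s))
      (ih fun x hx ↦ h x (Multiset.mem_cons_of_mem hx))

/-- `‖∏ s‖ = ∏ ‖s‖` for a multiset. [folklore] -/
private theorem algNorm_multiset_prod (s : Multiset (AlgebraicClosure F)) :
    algNorm F s.prod = (s.map (algNorm F)).prod := by
  induction s using Multiset.induction_on with
  | empty => simp [algNorm_one]
  | cons a s ih => rw [Multiset.prod_cons, Multiset.map_cons, Multiset.prod_cons, algNorm_mul, ih]

section Integers

variable (hirr : Irreducible ((3 : ℕ) : 𝒪[F]))
include hirr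

/-- `0 < ‖3‖ < 1`. [folklore] -/
private theorem algNorm_three_pos_lt_one :
    0 < algNorm F (3 : AlgebraicClosure F) ∧ algNorm F (3 : AlgebraicClosure F) < 1 := by
  have h1 := algNorm_uniformizer_pos hirr
  have h2 := algNorm_uniformizer_lt_one hirr
  rw [map_natCast] at h1 h2
  exact ⟨by simpa using h1, by simpa using h2⟩

/-- `‖2‖ = 1` (`1 = 3 - 2`). [folklore] -/
private theorem algNorm_two : algNorm F (2 : AlgebraicClosure F) = 1 := by
  have h2le : algNorm F (2 : AlgebraicClosure F) ≤ 1 := by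
    have h := algNorm_algebraMap_integer (F := F) ((2 : ℕ) : 𝒪[F])
    rw [map_natCast] at h
    simpa using h
  have h3 : algNorm F (3 : AlgebraicClosure F) < 1 := (algNorm_three_pos_lt_one hirr).2
  by_contra hne
  have hlt : algNorm F (2 : AlgebraicClosure F) < 1 := lt_of_le_of_ne h2le hne
  have h1 : algNorm F (1 : AlgebraicClosure F) < 1 := by
    have h : (1 : AlgebraicClosure F) = 3 - 2 := by norm_num
    rw [h]
    exact algNorm_sub_lt h3 hlt
  rw [algNorm_one] at h1
  exact lt_irrefl _ h1

/-- `‖4‖ = 1`. [folklore] -/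
private theorem algNorm_four : algNorm F (4 : AlgebraicClosure F) = 1 := by
  rw [show (4 : AlgebraicClosure F) = 2 * 2 by norm_num, algNorm_mul, algNorm_two hirr, one_mul]

end Integers

/-! ## §1. Newton polygon of `Ψ₃` in the irreducible case: all roots of norm `‖3‖^{1/4}` (III),
resp. `‖3‖^{5/4}` (III*) -/

section CaseI

variable (X : WeierstrassCurve (AlgebraicClosure F))

/-- **Type III, `‖b₂‖ ≤ ‖3‖²`: every root of `Ψ₃` has `‖x‖⁴ = ‖3‖`** (Newton polygon of
`Ψ₃ = 3x⁴ + b₂x³ + 3b₄x² + 3b₆x + b₈` a single side of slope `−1/4`: if `‖x‖⁴ > ‖3‖` the term `3x⁴`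
dominates, if `‖x‖⁴ < ‖3‖` the term `b₈` dominates). [cite: SerreInventiones1972, §1.9–1.10]
[cite: NeukirchANT1999, Ch. II (6.3)–(6.4)] -/
theorem algNorm_root_Ψ₃_pow_four_III (hirr : Irreducible ((3 : ℕ) : 𝒪[F]))
    (hb₂ : algNorm F X.b₂ ≤ algNorm F (3 : AlgebraicClosure F) ^ 2)
    (hb₄ : algNorm F X.b₄ ≤ algNorm F (3 : AlgebraicClosure F))
    (hb₆ : algNorm F X.b₆ ≤ algNorm F (3 : AlgebraicClosure F) ^ 2)
    (hb₈ : algNorm F X.b₈ = algNorm F (3 : AlgebraicClosure F) ^ 2)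
    {x : AlgebraicClosure F} (hroot : X.Ψ₃.eval x = 0) :
    algNorm F x ^ 4 = algNorm F (3 : AlgebraicClosure F) := by
  obtain ⟨hq0, hq1⟩ := algNorm_three_pos_lt_one hirr
  set q := algNorm F (3 : AlgebraicClosure F) with hq
  set N := algNorm F x with hN
  have hN0 : 0 ≤ N := algNorm_nonneg _
  have hA : algNorm F (3 * x ^ 4) = q * N ^ 4 := by rw [algNorm_mul, algNorm_pow]
  have hB : algNorm F (X.b₂ * x ^ 3) ≤ q ^ 2 * N ^ 3 := by
    rw [algNorm_mul, algNorm_pow]; exact mul_le_mul_of_nonneg_right hb₂ (pow_nonneg hN0 3)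
  have hC : algNorm F (3 * X.b₄ * x ^ 2) ≤ q * q * N ^ 2 := by
    rw [algNorm_mul, algNorm_mul, algNorm_pow]
    exact mul_le_mul_of_nonneg_right (mul_le_mul_of_nonneg_left hb₄ hq0.le) (pow_nonneg hN0 2)
  have hD : algNorm F (3 * X.b₆ * x) ≤ q * q ^ 2 * N := by
    rw [algNorm_mul, algNorm_mul]
    exact mul_le_mul_of_nonneg_right (mul_le_mul_of_nonneg_left hb₆ hq0.le) hN0
  have hq2 : q ^ 2 < q := by
    calc q ^ 2 < q ^ 1 := pow_lt_pow_right_of_lt_one₀ hq0 hq1 (by norm_num)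
      _ = q := pow_one q
  rcases lt_trichotomy (N ^ 4) q with hlt | heq | hgt
  · -- `b₈` dominates
    exfalso
    have hN1 : N < 1 := by
      by_contra h
      have : 1 ≤ N ^ 4 := one_le_pow₀ (not_lt.mp h)
      linarith
    rw [X.eval_Ψ₃_eq, show 3 * x ^ 4 + X.b₂ * x ^ 3 + 3 * X.b₄ * x ^ 2 + 3 * X.b₆ * x + X.b₈ =
      X.b₈ + (3 * x ^ 4 + X.b₂ * x ^ 3 + 3 * X.b₄ * x ^ 2 + 3 * X.b₆ * x) by ring] at hroot
    refine add_ne_zero_of_algNorm_lt ?_ hroot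
    rw [hb₈]
    have hN3 : N ^ 3 < 1 := pow_lt_one₀ hN0 hN1 three_ne_zero
    have hN2 : N ^ 2 < 1 := pow_lt_one₀ hN0 hN1 two_ne_zero
    refine algNorm_add_lt (algNorm_add_lt (algNorm_add_lt ?_ ?_) ?_) ?_
    · rw [hA]
      calc q * N ^ 4 < q * q := mul_lt_mul_of_pos_left hlt hq0
        _ = q ^ 2 := (sq q).symm
    · refine lt_of_le_of_lt hB ?_
      calc q ^ 2 * N ^ 3 < q ^ 2 * 1 := mul_lt_mul_of_pos_left hN3 (pow_pos hq0 2)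
        _ = q ^ 2 := mul_one _
    · refine lt_of_le_of_lt hC ?_
      calc q * q * N ^ 2 < q * q * 1 := mul_lt_mul_of_pos_left hN2 (mul_pos hq0 hq0)
        _ = q ^ 2 := by ring
    · refine lt_of_le_of_lt hD ?_
      calc q * q ^ 2 * N ≤ q * q ^ 2 * 1 := mul_le_mul_of_nonneg_left hN1.le (by positivity)
        _ = q * q ^ 2 := mul_one _
        _ < 1 * q ^ 2 := mul_lt_mul_of_pos_right hq1 (pow_pos hq0 2)
        _ = q ^ 2 := one_mul _
  · exact heq
  · -- `3x⁴` dominates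
    exfalso
    have hNq : q < N := by
      by_contra h
      have h' : N ≤ q := not_lt.mp h
      have h4 : N ^ 4 ≤ q ^ 4 := pow_le_pow_left₀ hN0 h' 4
      have hq4 : q ^ 4 ≤ q := by
        calc q ^ 4 ≤ q ^ 1 := pow_le_pow_of_le_one hq0.le hq1.le (by norm_num)
          _ = q := pow_one q
      linarith
    have hNpos : 0 < N := hq0.trans hNq
    -- `q < N²` and `q² < N³`
    have hN2 : q < N ^ 2 := by
      have h1 : q ^ 2 < (N ^ 2) ^ 2 := by
        calc q ^ 2 < q := hq2
          _ < N ^ 4 := hgt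
          _ = (N ^ 2) ^ 2 := by ring
      exact lt_of_pow_lt_pow_left₀ 2 (pow_nonneg hN0 2) h1
    have hN3 : q ^ 2 < N ^ 3 := by
      rcases le_or_gt N 1 with hle | hgt1
      · calc q ^ 2 < q := hq2
          _ < N ^ 4 := hgt
          _ ≤ N ^ 3 := pow_le_pow_of_le_one hN0 hle (by norm_num)
      · calc q ^ 2 < 1 := by nlinarith
          _ < N ^ 3 := one_lt_pow₀ hgt1 three_ne_zero
    rw [X.eval_Ψ₃_eq, show 3 * x ^ 4 + X.b₂ * x ^ 3 + 3 * X.b₄ * x ^ 2 + 3 * X.b₆ * x + X.b₈ =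
      3 * x ^ 4 + (X.b₂ * x ^ 3 + 3 * X.b₄ * x ^ 2 + 3 * X.b₆ * x + X.b₈) by ring] at hroot
    refine add_ne_zero_of_algNorm_lt ?_ hroot
    rw [hA]
    refine algNorm_add_lt (algNorm_add_lt (algNorm_add_lt ?_ ?_) ?_) ?_
    · refine lt_of_le_of_lt hB ?_
      rw [show q ^ 2 * N ^ 3 = q * N ^ 3 * q by ring, show q * N ^ 4 = q * N ^ 3 * N by ring]
      exact mul_lt_mul_of_pos_left hNq (by positivity)
    · refine lt_of_le_of_lt hC ?_
      rw [show q * q * N ^ 2 = q * N ^ 2 * q by ring, show q * N ^ 4 = q * N ^ 2 * N ^ 2 by ring]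
      exact mul_lt_mul_of_pos_left hN2 (by positivity)
    · refine lt_of_le_of_lt hD ?_
      rw [show q * q ^ 2 * N = q * N * q ^ 2 by ring, show q * N ^ 4 = q * N * N ^ 3 by ring]
      exact mul_lt_mul_of_pos_left hN3 (by positivity)
    · rw [hb₈]
      calc q ^ 2 = q * q := sq q
        _ < q * N ^ 4 := mul_lt_mul_of_pos_left hgt hq0

/-- **Type III*, `‖b₂‖ ≤ ‖3‖³`: every root of `Ψ₃` has `‖x‖⁴ = ‖3‖⁵`** (`‖b₄‖ ≤ ‖3‖³`,
`‖b₆‖ ≤ ‖3‖⁵`, `‖b₈‖ = ‖3‖⁶`; single side of slope `−5/4`). [cite: SerreInventiones1972, §1.9–1.10]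
[cite: NeukirchANT1999, Ch. II (6.3)–(6.4)] -/
theorem algNorm_root_Ψ₃_pow_four_IIIstar (hirr : Irreducible ((3 : ℕ) : 𝒪[F]))
    (hb₂ : algNorm F X.b₂ ≤ algNorm F (3 : AlgebraicClosure F) ^ 3)
    (hb₄ : algNorm F X.b₄ ≤ algNorm F (3 : AlgebraicClosure F) ^ 3)
    (hb₆ : algNorm F X.b₆ ≤ algNorm F (3 : AlgebraicClosure F) ^ 5)
    (hb₈ : algNorm F X.b₈ = algNorm F (3 : AlgebraicClosure F) ^ 6)
    {x : AlgebraicClosure F} (hroot : X.Ψ₃.eval x = 0) :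
    algNorm F x ^ 4 = algNorm F (3 : AlgebraicClosure F) ^ 5 := by
  obtain ⟨hq0, hq1⟩ := algNorm_three_pos_lt_one hirr
  set q := algNorm F (3 : AlgebraicClosure F) with hq
  set N := algNorm F x with hN
  have hN0 : 0 ≤ N := algNorm_nonneg _
  have hA : algNorm F (3 * x ^ 4) = q * N ^ 4 := by rw [algNorm_mul, algNorm_pow]
  have hB : algNorm F (X.b₂ * x ^ 3) ≤ q ^ 3 * N ^ 3 := by
    rw [algNorm_mul, algNorm_pow]; exact mul_le_mul_of_nonneg_right hb₂ (pow_nonneg hN0 3)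
  have hC : algNorm F (3 * X.b₄ * x ^ 2) ≤ q * q ^ 3 * N ^ 2 := by
    rw [algNorm_mul, algNorm_mul, algNorm_pow]
    exact mul_le_mul_of_nonneg_right (mul_le_mul_of_nonneg_left hb₄ hq0.le) (pow_nonneg hN0 2)
  have hD : algNorm F (3 * X.b₆ * x) ≤ q * q ^ 5 * N := by
    rw [algNorm_mul, algNorm_mul]
    exact mul_le_mul_of_nonneg_right (mul_le_mul_of_nonneg_left hb₆ hq0.le) hN0
  have hqpow : ∀ {m n : ℕ}, m < n → q ^ n < q ^ m := fun h ↦ pow_lt_pow_right_of_lt_one₀ hq0 hq1 h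
  rcases lt_trichotomy (N ^ 4) (q ^ 5) with hlt | heq | hgt
  · -- `b₈` dominates; first `N < q`
    exfalso
    have hNq : N < q := by
      by_contra h
      have : q ^ 4 ≤ N ^ 4 := pow_le_pow_left₀ hq0.le (not_lt.mp h) 4
      have : q ^ 5 < q ^ 4 := hqpow (by norm_num)
      linarith
    have hN1 : N < 1 := hNq.trans hq1
    rw [X.eval_Ψ₃_eq, show 3 * x ^ 4 + X.b₂ * x ^ 3 + 3 * X.b₄ * x ^ 2 + 3 * X.b₆ * x + X.b₈ =
      X.b₈ + (3 * x ^ 4 + X.b₂ * x ^ 3 + 3 * X.b₄ * x ^ 2 + 3 * X.b₆ * x) by ring] at hroot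
    refine add_ne_zero_of_algNorm_lt ?_ hroot
    rw [hb₈]
    have hN3 : N ^ 3 < q ^ 3 := pow_lt_pow_left₀ hNq hN0 three_ne_zero
    have hN2 : N ^ 2 < q ^ 2 := pow_lt_pow_left₀ hNq hN0 two_ne_zero
    refine algNorm_add_lt (algNorm_add_lt (algNorm_add_lt ?_ ?_) ?_) ?_
    · rw [hA]
      calc q * N ^ 4 < q * q ^ 5 := mul_lt_mul_of_pos_left hlt hq0
        _ = q ^ 6 := by ring
    · refine lt_of_le_of_lt hB ?_
      calc q ^ 3 * N ^ 3 < q ^ 3 * q ^ 3 := mul_lt_mul_of_pos_left hN3 (pow_pos hq0 3)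
        _ = q ^ 6 := by ring
    · refine lt_of_le_of_lt hC ?_
      calc q * q ^ 3 * N ^ 2 < q * q ^ 3 * q ^ 2 := mul_lt_mul_of_pos_left hN2 (by positivity)
        _ = q ^ 6 := by ring
    · refine lt_of_le_of_lt hD ?_
      calc q * q ^ 5 * N < q * q ^ 5 * 1 := mul_lt_mul_of_pos_left hN1 (by positivity)
        _ = q ^ 6 := by ring
  · exact heq
  · -- `3x⁴` dominates; first `q² < N`
    exfalso
    have hNq : q ^ 2 < N := by
      by_contra h
      have h' : N ≤ q ^ 2 := not_lt.mp h
      have h4 : N ^ 4 ≤ (q ^ 2) ^ 4 := pow_le_pow_left₀ hN0 h' 4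
      have h8 : (q ^ 2) ^ 4 = q ^ 8 := by ring
      have : q ^ 8 < q ^ 5 := hqpow (by norm_num)
      linarith
    have hNpos : 0 < N := lt_trans (by positivity) hNq
    have hN2 : q ^ 3 < N ^ 2 := by
      have h1 : (q ^ 3) ^ 2 < (N ^ 2) ^ 2 := by
        calc (q ^ 3) ^ 2 = q ^ 6 := by ring
          _ < q ^ 5 := hqpow (by norm_num)
          _ < N ^ 4 := hgt
          _ = (N ^ 2) ^ 2 := by ring
      exact lt_of_pow_lt_pow_left₀ 2 (pow_nonneg hN0 2) h1
    have hN3 : q ^ 5 < N ^ 3 := by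
      rcases le_or_gt N 1 with hle | hgt1
      · calc q ^ 5 < N ^ 4 := hgt
          _ ≤ N ^ 3 := pow_le_pow_of_le_one hN0 hle (by norm_num)
      · calc q ^ 5 < 1 := pow_lt_one₀ hq0.le hq1 (by norm_num)
          _ < N ^ 3 := one_lt_pow₀ hgt1 three_ne_zero
    rw [X.eval_Ψ₃_eq, show 3 * x ^ 4 + X.b₂ * x ^ 3 + 3 * X.b₄ * x ^ 2 + 3 * X.b₆ * x + X.b₈ =
      3 * x ^ 4 + (X.b₂ * x ^ 3 + 3 * X.b₄ * x ^ 2 + 3 * X.b₆ * x + X.b₈) by ring] at hroot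
    refine add_ne_zero_of_algNorm_lt ?_ hroot
    rw [hA]
    refine algNorm_add_lt (algNorm_add_lt (algNorm_add_lt ?_ ?_) ?_) ?_
    · refine lt_of_le_of_lt hB ?_
      rw [show q ^ 3 * N ^ 3 = q * N ^ 3 * q ^ 2 by ring, show q * N ^ 4 = q * N ^ 3 * N by ring]
      exact mul_lt_mul_of_pos_left hNq (by positivity)
    · refine lt_of_le_of_lt hC ?_
      rw [show q * q ^ 3 * N ^ 2 = q * N ^ 2 * q ^ 3 by ring, show q * N ^ 4 = q * N ^ 2 * N ^ 2 by ring]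
      exact mul_lt_mul_of_pos_left hN2 (by positivity)
    · refine lt_of_le_of_lt hD ?_
      rw [show q * q ^ 5 * N = q * N * q ^ 5 by ring, show q * N ^ 4 = q * N * N ^ 3 by ring]
      exact mul_lt_mul_of_pos_left hN3 (by positivity)
    · rw [hb₈]
      calc q ^ 6 = q * q ^ 5 := by ring
        _ < q * N ^ 4 := mul_lt_mul_of_pos_left hgt hq0

end CaseI

/-! ## §2. `Ψ₂²` at the roots; no root of norm `> ‖3‖` on type III* -/

section PsiTwo

variable (X : WeierstrassCurve (AlgebraicClosure F))

omit [ValuativeRel F] [TopologicalSpace F] [IsNonarchimedeanLocalField F] in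
/-- `Ψ₂²(x) = 4x³ + b₂x² + 2b₄x + b₆`. [folklore] -/
private theorem eval_Ψ₂Sq_eq' (x : AlgebraicClosure F) :
    X.Ψ₂Sq.eval x = 4 * x ^ 3 + X.b₂ * x ^ 2 + 2 * X.b₄ * x + X.b₆ := by
  simp only [WeierstrassCurve.Ψ₂Sq, eval_add, eval_mul, eval_pow, eval_C, eval_X]

/-- **Type III, case I: `‖Ψ₂²(x)‖⁴ = ‖3‖³` at a root of norm `‖x‖⁴ = ‖3‖`** (the term `4x³`
dominates `b₂x² + 2b₄x + b₆`). [cite: SilvermanAEC2009, III Ex. 3.7] -/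
theorem algNorm_eval_Ψ₂Sq_pow_four_III (hirr : Irreducible ((3 : ℕ) : 𝒪[F]))
    (hb₂ : algNorm F X.b₂ ≤ algNorm F (3 : AlgebraicClosure F) ^ 2)
    (hb₄ : algNorm F X.b₄ ≤ algNorm F (3 : AlgebraicClosure F))
    (hb₆ : algNorm F X.b₆ ≤ algNorm F (3 : AlgebraicClosure F) ^ 2)
    {x : AlgebraicClosure F} (hx : algNorm F x ^ 4 = algNorm F (3 : AlgebraicClosure F)) :
    algNorm F (X.Ψ₂Sq.eval x) ^ 4 = algNorm F (3 : AlgebraicClosure F) ^ 3 := by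
  obtain ⟨hq0, hq1⟩ := algNorm_three_pos_lt_one hirr
  have n2 := algNorm_two hirr
  have n4 := algNorm_four hirr
  set q := algNorm F (3 : AlgebraicClosure F) with hq
  set M := algNorm F x with hM
  have hM0 : 0 ≤ M := algNorm_nonneg _
  have hMpos : 0 < M := by
    rcases hM0.eq_or_lt with h | h
    · rw [← h, zero_pow four_ne_zero] at hx; exact absurd hx hq0.ne
    · exact h
  have hM1 : M < 1 := by
    by_contra h
    have : 1 ≤ M ^ 4 := one_le_pow₀ (not_lt.mp h)
    linarith
  -- `q² < M`, `q < M²`, `q² < M³`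
  have hMq2 : q ^ 2 < M := by
    have h1 : (q ^ 2) ^ 4 < M ^ 4 := by
      rw [hx]
      calc (q ^ 2) ^ 4 = q ^ 8 := by ring
        _ < q ^ 1 := pow_lt_pow_right_of_lt_one₀ hq0 hq1 (by norm_num)
        _ = q := pow_one q
    exact lt_of_pow_lt_pow_left₀ 4 hM0 h1
  have hMq : q < M ^ 2 := by
    have h1 : q ^ 2 < (M ^ 2) ^ 2 := by
      rw [show (M ^ 2) ^ 2 = M ^ 4 by ring, hx, sq]
      exact mul_lt_of_lt_one_left hq0 hq1
    exact lt_of_pow_lt_pow_left₀ 2 (pow_nonneg hM0 2) h1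
  have hM3 : q ^ 2 < M ^ 3 := by
    calc q ^ 2 < q := by rw [sq]; exact mul_lt_of_lt_one_left hq0 hq1
      _ = M ^ 4 := hx.symm
      _ ≤ M ^ 3 := pow_le_pow_of_le_one hM0 hM1.le (by norm_num)
  have hlead : algNorm F (4 * x ^ 3) = M ^ 3 := by rw [algNorm_mul, n4, one_mul, algNorm_pow]
  have hdom : algNorm F (X.b₂ * x ^ 2 + 2 * X.b₄ * x + X.b₆) < M ^ 3 := by
    refine algNorm_add_lt (algNorm_add_lt ?_ ?_) (hb₆.trans_lt hM3)
    · rw [algNorm_mul, algNorm_pow]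
      calc algNorm F X.b₂ * M ^ 2 ≤ q ^ 2 * M ^ 2 := mul_le_mul_of_nonneg_right hb₂ (pow_nonneg hM0 2)
        _ < M * M ^ 2 := mul_lt_mul_of_pos_right hMq2 (pow_pos hMpos 2)
        _ = M ^ 3 := by ring
    · rw [algNorm_mul, algNorm_mul, n2, one_mul]
      calc algNorm F X.b₄ * M ≤ q * M := mul_le_mul_of_nonneg_right hb₄ hM0
        _ < M ^ 2 * M := mul_lt_mul_of_pos_right hMq hMpos
        _ = M ^ 3 := by ring
  rw [eval_Ψ₂Sq_eq', show 4 * x ^ 3 + X.b₂ * x ^ 2 + 2 * X.b₄ * x + X.b₆ =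
    4 * x ^ 3 + (X.b₂ * x ^ 2 + 2 * X.b₄ * x + X.b₆) by ring, algNorm_add_eq_left (by rwa [hlead]),
    hlead, ← hx]
  ring

/-- **Type III*, case I: `‖Ψ₂²(x)‖⁴ = ‖3‖¹⁵` at a root of norm `‖x‖⁴ = ‖3‖⁵`.**
[cite: SilvermanAEC2009, III Ex. 3.7] -/
theorem algNorm_eval_Ψ₂Sq_pow_four_IIIstar (hirr : Irreducible ((3 : ℕ) : 𝒪[F]))
    (hb₂ : algNorm F X.b₂ ≤ algNorm F (3 : AlgebraicClosure F) ^ 3)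
    (hb₄ : algNorm F X.b₄ ≤ algNorm F (3 : AlgebraicClosure F) ^ 3)
    (hb₆ : algNorm F X.b₆ ≤ algNorm F (3 : AlgebraicClosure F) ^ 5)
    {x : AlgebraicClosure F} (hx : algNorm F x ^ 4 = algNorm F (3 : AlgebraicClosure F) ^ 5) :
    algNorm F (X.Ψ₂Sq.eval x) ^ 4 = algNorm F (3 : AlgebraicClosure F) ^ 15 := by
  obtain ⟨hq0, hq1⟩ := algNorm_three_pos_lt_one hirr
  have n2 := algNorm_two hirr
  have n4 := algNorm_four hirr
  set q := algNorm F (3 : AlgebraicClosure F) with hq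
  set M := algNorm F x with hM
  have hM0 : 0 ≤ M := algNorm_nonneg _
  have hqpow : ∀ {m n : ℕ}, m < n → q ^ n < q ^ m := fun h ↦ pow_lt_pow_right_of_lt_one₀ hq0 hq1 h
  have hMpos : 0 < M := by
    rcases hM0.eq_or_lt with h | h
    · rw [← h, zero_pow four_ne_zero] at hx; exact absurd hx (pow_pos hq0 5).ne
    · exact h
  have hM1 : M < 1 := by
    by_contra h
    have : 1 ≤ M ^ 4 := one_le_pow₀ (not_lt.mp h)
    have : q ^ 5 < 1 := pow_lt_one₀ hq0.le hq1 (by norm_num)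
    linarith
  -- `q³ < M`, `q³ < M²`, `q⁵ < M³`
  have hMq3 : q ^ 3 < M := by
    have h1 : (q ^ 3) ^ 4 < M ^ 4 := by
      rw [hx]
      calc (q ^ 3) ^ 4 = q ^ 12 := by ring
        _ < q ^ 5 := hqpow (by norm_num)
    exact lt_of_pow_lt_pow_left₀ 4 hM0 h1
  have hMq : q ^ 3 < M ^ 2 := by
    have h1 : (q ^ 3) ^ 2 < (M ^ 2) ^ 2 := by
      calc (q ^ 3) ^ 2 = q ^ 6 := by ring
        _ < q ^ 5 := hqpow (by norm_num)
        _ = (M ^ 2) ^ 2 := by rw [← hx]; ring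
    exact lt_of_pow_lt_pow_left₀ 2 (pow_nonneg hM0 2) h1
  have hM3 : q ^ 5 < M ^ 3 := by
    calc q ^ 5 = M ^ 4 := hx.symm
      _ < M ^ 3 := pow_lt_pow_right_of_lt_one₀ hMpos hM1 (by norm_num)
  have hlead : algNorm F (4 * x ^ 3) = M ^ 3 := by rw [algNorm_mul, n4, one_mul, algNorm_pow]
  have hdom : algNorm F (X.b₂ * x ^ 2 + 2 * X.b₄ * x + X.b₆) < M ^ 3 := by
    refine algNorm_add_lt (algNorm_add_lt ?_ ?_) (hb₆.trans_lt hM3)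
    · rw [algNorm_mul, algNorm_pow]
      calc algNorm F X.b₂ * M ^ 2 ≤ q ^ 3 * M ^ 2 := mul_le_mul_of_nonneg_right hb₂ (pow_nonneg hM0 2)
        _ < M * M ^ 2 := mul_lt_mul_of_pos_right hMq3 (pow_pos hMpos 2)
        _ = M ^ 3 := by ring
    · rw [algNorm_mul, algNorm_mul, n2, one_mul]
      calc algNorm F X.b₄ * M ≤ q ^ 3 * M := mul_le_mul_of_nonneg_right hb₄ hM0
        _ < M ^ 2 * M := mul_lt_mul_of_pos_right hMq hMpos
        _ = M ^ 3 := by ring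
  rw [eval_Ψ₂Sq_eq', show 4 * x ^ 3 + X.b₂ * x ^ 2 + 2 * X.b₄ * x + X.b₆ =
    4 * x ^ 3 + (X.b₂ * x ^ 2 + 2 * X.b₄ * x + X.b₆) by ring, algNorm_add_eq_left (by rwa [hlead]),
    hlead, show (M ^ 3) ^ 4 = (M ^ 4) ^ 3 by ring, hx]
  ring

/-- **Type III*: no root of `Ψ₃` of norm `> ‖3‖`** (then `3x⁴` dominates; all roots have
`‖x‖ ≤ ‖3‖`). [cite: SilvermanAEC2009, III Ex. 3.7] -/
theorem eval_Ψ₃_ne_zero_of_three_lt_algNorm_IIIstar (hirr : Irreducible ((3 : ℕ) : 𝒪[F]))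
    (hb₂ : algNorm F X.b₂ ≤ algNorm F (3 : AlgebraicClosure F) ^ 2)
    (hb₄ : algNorm F X.b₄ ≤ algNorm F (3 : AlgebraicClosure F) ^ 3)
    (hb₆ : algNorm F X.b₆ ≤ algNorm F (3 : AlgebraicClosure F) ^ 5)
    (hb₈ : algNorm F X.b₈ = algNorm F (3 : AlgebraicClosure F) ^ 6)
    {x : AlgebraicClosure F} (hx : algNorm F (3 : AlgebraicClosure F) < algNorm F x) :
    X.Ψ₃.eval x ≠ 0 := by
  obtain ⟨hq0, hq1⟩ := algNorm_three_pos_lt_one hirr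
  set q := algNorm F (3 : AlgebraicClosure F) with hq
  set N := algNorm F x with hN
  have hN0 : 0 < N := hq0.trans hx
  have hqpow : ∀ {m n : ℕ}, m < n → q ^ n < q ^ m := fun h ↦ pow_lt_pow_right_of_lt_one₀ hq0 hq1 h
  have hA : algNorm F (3 * x ^ 4) = q * N ^ 4 := by rw [algNorm_mul, algNorm_pow]
  rw [X.eval_Ψ₃_eq, show 3 * x ^ 4 + X.b₂ * x ^ 3 + 3 * X.b₄ * x ^ 2 + 3 * X.b₆ * x + X.b₈ =
    3 * x ^ 4 + (X.b₂ * x ^ 3 + 3 * X.b₄ * x ^ 2 + 3 * X.b₆ * x + X.b₈) by ring]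
  refine add_ne_zero_of_algNorm_lt ?_
  rw [hA]
  have hq2N : q ^ 2 < N ^ 2 := pow_lt_pow_left₀ hx hq0.le two_ne_zero
  have hq3N : q ^ 3 < N ^ 3 := pow_lt_pow_left₀ hx hq0.le three_ne_zero
  have hq4N : q ^ 4 < N ^ 4 := pow_lt_pow_left₀ hx hq0.le four_ne_zero
  refine algNorm_add_lt (algNorm_add_lt (algNorm_add_lt ?_ ?_) ?_) ?_
  · rw [algNorm_mul, algNorm_pow]
    calc algNorm F X.b₂ * N ^ 3 ≤ q ^ 2 * N ^ 3 := mul_le_mul_of_nonneg_right hb₂ (pow_nonneg hN0.le 3)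
      _ = q * N ^ 3 * q := by ring
      _ < q * N ^ 3 * N := mul_lt_mul_of_pos_left hx (by positivity)
      _ = q * N ^ 4 := by ring
  · rw [algNorm_mul, algNorm_mul, algNorm_pow]
    calc q * algNorm F X.b₄ * N ^ 2 ≤ q * q ^ 3 * N ^ 2 :=
          mul_le_mul_of_nonneg_right (mul_le_mul_of_nonneg_left hb₄ hq0.le) (pow_nonneg hN0.le 2)
      _ = q * N ^ 2 * q ^ 3 := by ring
      _ < q * N ^ 2 * q ^ 2 := mul_lt_mul_of_pos_left (hqpow (by norm_num)) (by positivity)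
      _ < q * N ^ 2 * N ^ 2 := mul_lt_mul_of_pos_left hq2N (by positivity)
      _ = q * N ^ 4 := by ring
  · rw [algNorm_mul, algNorm_mul]
    calc q * algNorm F X.b₆ * N ≤ q * q ^ 5 * N :=
          mul_le_mul_of_nonneg_right (mul_le_mul_of_nonneg_left hb₆ hq0.le) hN0.le
      _ = q * N * q ^ 5 := by ring
      _ < q * N * q ^ 3 := mul_lt_mul_of_pos_left (hqpow (by norm_num)) (by positivity)
      _ < q * N * N ^ 3 := mul_lt_mul_of_pos_left hq3N (by positivity)
      _ = q * N ^ 4 := by ring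
  · rw [hb₈]
    calc q ^ 6 < q ^ 5 := hqpow (by norm_num)
      _ = q * q ^ 4 := by ring
      _ < q * N ^ 4 := mul_lt_mul_of_pos_left hq4N hq0

end PsiTwo

/-! ## §3. The reducible configuration: `‖b₂‖ = ‖3‖` (III) / `‖b₂‖ = ‖3‖²` (III*) forces an
`F`-rational root of `Ψ₃` -/

section Vieta

variable (X : WeierstrassCurve (AlgebraicClosure F))

/-- **Four numbers with a unique one of top size.**  Let `S` be a multiset of four elements of
`F̄` of norm `≤ t`, with `S.sum = -c`, `‖c‖ = t`, `‖S.prod‖ < t⁴`, and such that every element of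
norm `t` is `≡ -c`, i.e. `‖r + c‖ < t`.  Then `S` has an element of norm `t`, and any two elements
of norm `t` are equal: if `r₁ ≠ r₂` had norm `t`, the other two would sum to `≡ -2c - r₁ - r₂ ≡ c`
(hence one of them, `r₃`, has norm `t`, `r₃ ≡ -c`) and the last would be `≡ 2c`, of norm `t`
(`‖2‖ = 1`): all four of norm `t`, contradicting `‖S.prod‖ < t⁴`.  (Residue characteristic `3`:
`1 + 1 + 1 + 1 ≢ 0` is not used — only `‖2‖ = 1`.) [folklore] -/
private theorem exists_unique_algNorm_eq_of_card_eq_four (hirr : Irreducible ((3 : ℕ) : 𝒪[F]))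
    {S : Multiset (AlgebraicClosure F)} (hS : Multiset.card S = 4) {c : AlgebraicClosure F} {t : ℝ}
    (ht : 0 < t) (hc : algNorm F c = t) (hsum : S.sum = -c) (hprod : algNorm F S.prod < t ^ 4)
    (hle : ∀ r ∈ S, algNorm F r ≤ t) (htop : ∀ r ∈ S, algNorm F r = t → algNorm F (r + c) < t) :
    (∃ r ∈ S, algNorm F r = t) ∧
      ∀ r₁ ∈ S, ∀ r₂ ∈ S, algNorm F r₁ = t → algNorm F r₂ = t → r₁ = r₂ := by
  have n2 := algNorm_two hirr
  -- helper: `‖a - b‖ < t`, `‖b‖ = t`, `‖a‖ ≤ t` ⇒ `‖a‖ = t`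
  have key : ∀ {a b : AlgebraicClosure F}, algNorm F a ≤ t → algNorm F b = t →
      algNorm F (a - b) < t → algNorm F a = t := by
    intro a b ha hb h
    by_contra hne
    have hlt : algNorm F a < t := lt_of_le_of_ne ha hne
    have h1 : algNorm F (a - (a - b)) < t := algNorm_sub_lt hlt h
    rw [sub_sub_cancel, hb] at h1
    exact lt_irrefl _ h1
  constructor
  · by_contra hno
    push Not at hno
    have hlt : ∀ r ∈ S, algNorm F r < t := fun r hr ↦ lt_of_le_of_ne (hle r hr) (hno r hr)
    have h1 : algNorm F S.sum < t := algNorm_multiset_sum_lt ht hlt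
    rw [hsum, algNorm_neg, hc] at h1
    exact lt_irrefl _ h1
  · intro r₁ hr₁ r₂ hr₂ h₁ h₂
    by_contra hne
    -- `S = r₁ :: r₂ :: {r₃, r₄}`
    obtain ⟨S₁, rfl⟩ := Multiset.exists_cons_of_mem hr₁
    have hr₂' : r₂ ∈ S₁ := by
      rcases Multiset.mem_cons.mp hr₂ with h | h
      · exact absurd h.symm hne
      · exact h
    obtain ⟨T, rfl⟩ := Multiset.exists_cons_of_mem hr₂'
    have hT : Multiset.card T = 2 := by simpa using hS
    obtain ⟨r₃, r₄, rfl⟩ := Multiset.card_eq_two.mp hT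
    simp only [Multiset.sum_cons, Multiset.insert_eq_cons, Multiset.sum_singleton,
      Multiset.prod_cons, Multiset.prod_singleton] at hsum hprod
    have hmem₃ : r₃ ∈ r₁ ::ₘ r₂ ::ₘ ({r₃, r₄} : Multiset (AlgebraicClosure F)) := by simp
    have hmem₄ : r₄ ∈ r₁ ::ₘ r₂ ::ₘ ({r₃, r₄} : Multiset (AlgebraicClosure F)) := by simp
    have h₃le := hle r₃ hmem₃
    have h₄le := hle r₄ hmem₄
    have hc₁ := htop r₁ hr₁ h₁
    have hc₂ := htop r₂ hr₂ h₂
    -- `r₃ + r₄ - c = -(r₁ + c) - (r₂ + c)`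
    have h34 : algNorm F (r₃ + r₄ - c) < t := by
      rw [show r₃ + r₄ - c = -(r₁ + c) - (r₂ + c) by linear_combination hsum]
      exact algNorm_sub_lt (by rwa [algNorm_neg]) hc₂
    have h34' : algNorm F (r₃ + r₄) = t :=
      key ((algNorm_add_le _ _).trans (max_le h₃le h₄le)) hc h34
    -- one of `r₃, r₄` has norm `t`; then so does the other
    have htwo : ∀ {a b : AlgebraicClosure F},
        a ∈ r₁ ::ₘ r₂ ::ₘ ({r₃, r₄} : Multiset (AlgebraicClosure F)) →
        algNorm F a = t → algNorm F b ≤ t → algNorm F (a + b - c) < t → algNorm F b = t := by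
      intro a b ha hat hbt hab
      have hac := htop a ha hat
      -- `b - 2c = (a + b - c) - (a + c)`
      have h1 : algNorm F (b - 2 * c) < t := by
        rw [show b - 2 * c = (a + b - c) - (a + c) by ring]
        exact algNorm_sub_lt hab hac
      exact key hbt (by rw [algNorm_mul, n2, one_mul, hc]) h1
    have h₃₄ : algNorm F r₃ = t ∧ algNorm F r₄ = t := by
      rcases le_max_iff.mp (h34'.symm.le.trans (algNorm_add_le r₃ r₄)) with h | h
      · have h₃ : algNorm F r₃ = t := le_antisymm h₃le h
        exact ⟨h₃, htwo hmem₃ h₃ h₄le h34⟩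
      · have h₄ : algNorm F r₄ = t := le_antisymm h₄le h
        exact ⟨htwo hmem₄ h₄ h₃le (by rwa [add_comm r₄ r₃]), h₄⟩
    -- all four of norm `t`: contradiction with the product
    have hp : algNorm F (r₁ * (r₂ * (r₃ * r₄))) = t ^ 4 := by
      rw [algNorm_mul, algNorm_mul, algNorm_mul, h₁, h₂, h₃₄.1, h₃₄.2]; ring
    rw [hp] at hprod
    exact lt_irrefl _ hprod

omit [ValuativeRel F] [TopologicalSpace F] [IsNonarchimedeanLocalField F] in
/-- **Vieta for `Ψ₃` over `F̄`**: the roots (with multiplicity) form a multiset of cardinality `4`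
with sum `-b₂/3` and `3 · ∏ = b₈` (`Ψ₃ = 3x⁴ + b₂x³ + 3b₄x² + 3b₆x + b₈`, leading coefficient `3`).
[cite: SilvermanAEC2009, III Ex. 3.7] -/
private theorem card_sum_prod_roots_Ψ₃ [CharZero F] :
    Multiset.card X.Ψ₃.roots = 4 ∧ X.Ψ₃.roots.sum = -(X.b₂ / 3) ∧ 3 * X.Ψ₃.roots.prod = X.b₈ := by
  haveI : CharZero (AlgebraicClosure F) :=
    charZero_of_injective_algebraMap (algebraMap F (AlgebraicClosure F)).injective
  have h3 : (3 : AlgebraicClosure F) ≠ 0 := by norm_num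
  have hsplit : X.Ψ₃.Splits := IsAlgClosed.splits X.Ψ₃
  have hdeg : X.Ψ₃.natDegree = 4 := X.natDegree_Ψ₃ h3
  have hlc : X.Ψ₃.leadingCoeff = 3 := X.leadingCoeff_Ψ₃ h3
  have hcard : Multiset.card X.Ψ₃.roots = 4 := by rw [← hdeg]; exact (hsplit.natDegree_eq_card_roots).symm
  have h3' : X.Ψ₃.coeff 3 = X.b₂ := by
    rw [WeierstrassCurve.Ψ₃, show (3 : (AlgebraicClosure F)[X]) = C 3 by rw [map_ofNat]]
    simp [coeff_X_pow, coeff_C_mul, mul_assoc]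
  have h0' : X.Ψ₃.coeff 0 = X.b₈ := by
    rw [WeierstrassCurve.Ψ₃, show (3 : (AlgebraicClosure F)[X]) = C 3 by rw [map_ofNat]]
    simp [coeff_X_pow, coeff_X, coeff_C, mul_assoc]
  have hnext : X.Ψ₃.nextCoeff = X.b₂ := by
    rw [nextCoeff_of_natDegree_pos (by rw [hdeg]; norm_num), hdeg]; exact h3'
  refine ⟨hcard, ?_, ?_⟩
  · have h := hsplit.nextCoeff_eq_neg_sum_roots_mul_leadingCoeff
    rw [hnext, hlc] at h
    field_simp
    linear_combination h
  · have h := hsplit.coeff_zero_eq_leadingCoeff_mul_prod_roots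
    rw [h0', hdeg, hlc] at h
    rw [h]; ring

/-- **Type III with `‖b₂‖ = ‖3‖`: a unique unit root of `Ψ₃`.**  Every root `r` has `‖r‖ ≤ 1`,
the unit roots satisfy `‖3r + b₂‖ ≤ ‖3‖²` (from `Ψ₃(r) = 0`: `3r³(r + b₂/3) = -(3b₄r² + 3b₆r + b₈)`),
`∑ roots = -b₂/3` is a unit and `‖∏ roots‖ = ‖b₈/3‖ = ‖3‖ < 1`; conclude by
`exists_unique_algNorm_eq_of_card_eq_four`. [cite: SilvermanATAEC1994, IV.9.4 Step 4]
[cite: NeukirchANT1999, Ch. II (6.3)–(6.4)] -/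
theorem exists_unique_root_Ψ₃_algNorm_eq_one_III [CharZero F] (hirr : Irreducible ((3 : ℕ) : 𝒪[F]))
    (hb₂ : algNorm F X.b₂ = algNorm F (3 : AlgebraicClosure F))
    (hb₄ : algNorm F X.b₄ = algNorm F (3 : AlgebraicClosure F))
    (hb₆ : algNorm F X.b₆ ≤ algNorm F (3 : AlgebraicClosure F) ^ 2)
    (hb₈ : algNorm F X.b₈ = algNorm F (3 : AlgebraicClosure F) ^ 2) :
    (∃ r, X.Ψ₃.eval r = 0 ∧ algNorm F r = 1) ∧
      ∀ r₁ r₂, X.Ψ₃.eval r₁ = 0 → X.Ψ₃.eval r₂ = 0 → algNorm F r₁ = 1 → algNorm F r₂ = 1 → r₁ = r₂ := by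
  haveI : CharZero (AlgebraicClosure F) :=
    charZero_of_injective_algebraMap (algebraMap F (AlgebraicClosure F)).injective
  obtain ⟨hq0, hq1⟩ := algNorm_three_pos_lt_one hirr
  set q := algNorm F (3 : AlgebraicClosure F) with hq
  have h3 : (3 : AlgebraicClosure F) ≠ 0 := by norm_num
  have hne : X.Ψ₃ ≠ 0 := X.Ψ₃_ne_zero h3
  obtain ⟨hcard, hsum, hprod⟩ := card_sum_prod_roots_Ψ₃ X
  have hmem : ∀ {r}, r ∈ X.Ψ₃.roots ↔ X.Ψ₃.eval r = 0 := fun {r} ↦ Polynomial.mem_roots hne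
  -- roots are `≤ 1`
  have hle : ∀ r ∈ X.Ψ₃.roots, algNorm F r ≤ 1 := by
    intro r hr
    by_contra h
    exact eval_Ψ₃_ne_zero_of_one_lt_algNorm_III X hirr hb₂.le hb₄ hb₆ hb₈ (not_le.mp h) (hmem.mp hr)
  -- unit roots are `≡ -b₂/3`
  have htop : ∀ r ∈ X.Ψ₃.roots, algNorm F r = 1 → algNorm F (r + X.b₂ / 3) < 1 := by
    intro r hr hr1
    have hroot : X.Ψ₃.eval r = 0 := hmem.mp hr
    rw [X.eval_Ψ₃_eq] at hroot
    -- `3 r³ (r + b₂/3) = -(3 b₄ r² + 3 b₆ r + b₈)`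
    have hid : 3 * r ^ 3 * (r + X.b₂ / 3) = -(3 * X.b₄ * r ^ 2 + 3 * X.b₆ * r + X.b₈) := by
      have h33 : (3 : AlgebraicClosure F) * (X.b₂ / 3) = X.b₂ := mul_div_cancel₀ X.b₂ h3
      linear_combination hroot + r ^ 3 * h33
    have hR : algNorm F (-(3 * X.b₄ * r ^ 2 + 3 * X.b₆ * r + X.b₈)) ≤ q ^ 2 := by
      rw [algNorm_neg]
      refine algNorm_add_le_of_le (algNorm_add_le_of_le ?_ ?_) hb₈.le
      · rw [algNorm_mul, algNorm_mul, hb₄, algNorm_pow, hr1, one_pow, mul_one, sq]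
      · rw [algNorm_mul, algNorm_mul, hr1, mul_one]
        calc q * algNorm F X.b₆ ≤ q * q ^ 2 := mul_le_mul_of_nonneg_left hb₆ hq0.le
          _ ≤ 1 * q ^ 2 := mul_le_mul_of_nonneg_right hq1.le (sq_nonneg q)
          _ = q ^ 2 := one_mul _
    have hL : algNorm F (3 * r ^ 3 * (r + X.b₂ / 3)) = q * algNorm F (r + X.b₂ / 3) := by
      rw [algNorm_mul, algNorm_mul, algNorm_pow, hr1, one_pow, mul_one]
    rw [hid] at hL
    have h1 : q * algNorm F (r + X.b₂ / 3) ≤ q ^ 2 := hL ▸ hR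
    calc algNorm F (r + X.b₂ / 3) ≤ q := by
          rw [sq] at h1; exact le_of_mul_le_mul_left h1 hq0
      _ < 1 := hq1
  have hc : algNorm F (X.b₂ / 3) = 1 := by rw [algNorm_div, hb₂, div_self hq0.ne']
  have hprod' : algNorm F X.Ψ₃.roots.prod < 1 ^ 4 := by
    have h := congrArg (algNorm F) hprod
    rw [algNorm_mul, hb₈, sq] at h
    have h' : algNorm F X.Ψ₃.roots.prod = q := mul_left_cancel₀ hq0.ne' h
    rw [h', one_pow]; exact hq1
  obtain ⟨⟨r, hr, hr1⟩, huniq⟩ := exists_unique_algNorm_eq_of_card_eq_four hirr hcard one_pos hc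
    hsum hprod' hle htop
  exact ⟨⟨r, hmem.mp hr, hr1⟩, fun r₁ r₂ h₁ h₂ ↦ huniq r₁ (hmem.mpr h₁) r₂ (hmem.mpr h₂)⟩

/-- **Type III* with `‖b₂‖ = ‖3‖²`: a unique root of `Ψ₃` of norm `‖3‖`** (all roots have norm
`≤ ‖3‖`; the roots of norm `‖3‖` satisfy `‖3r + b₂‖ ≤ ‖3‖³`; `∑ = -b₂/3` has norm `‖3‖`,
`‖∏‖ = ‖3‖⁵ < ‖3‖⁴`). [cite: SilvermanATAEC1994, IV.9.4 Step 9] [cite: NeukirchANT1999, Ch. II (6.3)–(6.4)] -/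
theorem exists_unique_root_Ψ₃_algNorm_eq_three_IIIstar [CharZero F]
    (hirr : Irreducible ((3 : ℕ) : 𝒪[F]))
    (hb₂ : algNorm F X.b₂ = algNorm F (3 : AlgebraicClosure F) ^ 2)
    (hb₄ : algNorm F X.b₄ = algNorm F (3 : AlgebraicClosure F) ^ 3)
    (hb₆ : algNorm F X.b₆ ≤ algNorm F (3 : AlgebraicClosure F) ^ 5)
    (hb₈ : algNorm F X.b₈ = algNorm F (3 : AlgebraicClosure F) ^ 6) :
    (∃ r, X.Ψ₃.eval r = 0 ∧ algNorm F r = algNorm F (3 : AlgebraicClosure F)) ∧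
      ∀ r₁ r₂, X.Ψ₃.eval r₁ = 0 → X.Ψ₃.eval r₂ = 0 →
        algNorm F r₁ = algNorm F (3 : AlgebraicClosure F) →
        algNorm F r₂ = algNorm F (3 : AlgebraicClosure F) → r₁ = r₂ := by
  haveI : CharZero (AlgebraicClosure F) :=
    charZero_of_injective_algebraMap (algebraMap F (AlgebraicClosure F)).injective
  obtain ⟨hq0, hq1⟩ := algNorm_three_pos_lt_one hirr
  set q := algNorm F (3 : AlgebraicClosure F) with hq
  have hqpow : ∀ {m n : ℕ}, m < n → q ^ n < q ^ m := fun h ↦ pow_lt_pow_right_of_lt_one₀ hq0 hq1 h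
  have h3 : (3 : AlgebraicClosure F) ≠ 0 := by norm_num
  have hne : X.Ψ₃ ≠ 0 := X.Ψ₃_ne_zero h3
  obtain ⟨hcard, hsum, hprod⟩ := card_sum_prod_roots_Ψ₃ X
  have hmem : ∀ {r}, r ∈ X.Ψ₃.roots ↔ X.Ψ₃.eval r = 0 := fun {r} ↦ Polynomial.mem_roots hne
  have hle : ∀ r ∈ X.Ψ₃.roots, algNorm F r ≤ q := by
    intro r hr
    by_contra h
    exact eval_Ψ₃_ne_zero_of_three_lt_algNorm_IIIstar X hirr hb₂.le hb₄.le hb₆ hb₈ (not_le.mp h)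
      (hmem.mp hr)
  have htop : ∀ r ∈ X.Ψ₃.roots, algNorm F r = q → algNorm F (r + X.b₂ / 3) < q := by
    intro r hr hr1
    have hroot : X.Ψ₃.eval r = 0 := hmem.mp hr
    rw [X.eval_Ψ₃_eq] at hroot
    have hid : 3 * r ^ 3 * (r + X.b₂ / 3) = -(3 * X.b₄ * r ^ 2 + 3 * X.b₆ * r + X.b₈) := by
      have h33 : (3 : AlgebraicClosure F) * (X.b₂ / 3) = X.b₂ := mul_div_cancel₀ X.b₂ h3
      linear_combination hroot + r ^ 3 * h33
    have hR : algNorm F (-(3 * X.b₄ * r ^ 2 + 3 * X.b₆ * r + X.b₈)) ≤ q ^ 6 := by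
      rw [algNorm_neg]
      refine algNorm_add_le_of_le (algNorm_add_le_of_le ?_ ?_) hb₈.le
      · rw [algNorm_mul, algNorm_mul, hb₄, algNorm_pow, hr1]; exact le_of_eq (by ring)
      · rw [algNorm_mul, algNorm_mul, hr1]
        calc q * algNorm F X.b₆ * q ≤ q * q ^ 5 * q :=
            mul_le_mul_of_nonneg_right (mul_le_mul_of_nonneg_left hb₆ hq0.le) hq0.le
          _ = q ^ 7 := by ring
          _ ≤ q ^ 6 := (hqpow (by norm_num)).le
    have hL : algNorm F (3 * r ^ 3 * (r + X.b₂ / 3)) = q ^ 4 * algNorm F (r + X.b₂ / 3) := by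
      rw [algNorm_mul, algNorm_mul, algNorm_pow, hr1]; ring
    rw [hid] at hL
    have h1 : q ^ 4 * algNorm F (r + X.b₂ / 3) ≤ q ^ 6 := hL ▸ hR
    calc algNorm F (r + X.b₂ / 3) ≤ q ^ 2 := by
          rw [show q ^ 6 = q ^ 4 * q ^ 2 by ring] at h1
          exact le_of_mul_le_mul_left h1 (pow_pos hq0 4)
      _ < q := by rw [sq]; exact mul_lt_of_lt_one_left hq0 hq1
  have hc : algNorm F (X.b₂ / 3) = q := by
    rw [algNorm_div, hb₂, sq, mul_div_assoc, div_self hq0.ne', mul_one]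
  have hprod' : algNorm F X.Ψ₃.roots.prod < q ^ 4 := by
    have h := congrArg (algNorm F) hprod
    rw [algNorm_mul, hb₈, show q ^ 6 = q * q ^ 5 by ring] at h
    have h' : algNorm F X.Ψ₃.roots.prod = q ^ 5 := mul_left_cancel₀ hq0.ne' h
    rw [h']; exact hqpow (by norm_num)
  obtain ⟨⟨r, hr, hr1⟩, huniq⟩ := exists_unique_algNorm_eq_of_card_eq_four hirr hcard hq0 hc hsum
    hprod' hle htop
  exact ⟨⟨r, hmem.mp hr, hr1⟩, fun r₁ r₂ h₁ h₂ ↦ huniq r₁ (hmem.mpr h₁) r₂ (hmem.mpr h₂)⟩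

end Vieta

/-! ### Galois descent of the unique top root; reducibility -/

section Descent

variable [CharZero F] (V : WeierstrassCurve F) [V.IsElliptic]

omit [ValuativeRel F] [TopologicalSpace F] [IsNonarchimedeanLocalField F] in
/-- **A root of `Ψ₃` singled out by its absolute value is `F`-rational, so `E[3]` is reducible.**
If `r ∈ F̄` is a root of `Ψ₃` (of `V/F`, read in `F̄`) and every root `r'` with `‖r'‖ = ‖r‖`
equals `r`, then `σ r = r` for all `σ ∈ Γ_F` (`Γ_F` permutes the roots isometrically), so `r ∈ F`
(Galois descent, `F` perfect) is an `F`-rational root of `Ψ₃`: `{O, ±T}` above it is a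
`Γ_F`-stable line (`not_hasIrreducibleModPGaloisRep_three_of_isRoot_Ψ₃`). [cite: Cremona1997, §3.8]
[cite: SilvermanAEC2009, III Ex. 3.7] -/
theorem not_hasIrreducibleModPGaloisRep_three_of_unique_root
    {N : AlgebraicClosure F → ℝ} (hN : ∀ (σ : absoluteGaloisGroup F) x, N (σ • x) = N x)
    {r : AlgebraicClosure F} (hr : (V.baseChange (AlgebraicClosure F)).Ψ₃.eval r = 0)
    (huniq : ∀ r', (V.baseChange (AlgebraicClosure F)).Ψ₃.eval r' = 0 → N r' = N r → r' = r) :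
    ¬ V.HasIrreducibleModPGaloisRep 3 := by
  have hfix : ∀ σ : absoluteGaloisGroup F, σ • r = r := by
    intro σ
    refine huniq _ ?_ (hN σ r)
    rw [WeierstrassCurve.baseChange, WeierstrassCurve.map_Ψ₃, eval_map, ← aeval_def] at hr ⊢
    rw [absoluteGaloisGroup.smul_def, ← AlgEquiv.coe_toAlgHom, aeval_algHom_apply, hr, map_zero]
  haveI : IsGalois F (AlgebraicClosure F) := {}
  obtain ⟨r₀, hr₀⟩ := (InfiniteGalois.mem_range_algebraMap_iff_fixed r).mpr fun σ ↦ hfix σ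
  refine V.not_hasIrreducibleModPGaloisRep_three_of_isRoot_Ψ₃ (x₀ := r₀) ?_
  rw [IsRoot.def]
  apply (algebraMap F (AlgebraicClosure F)).injective
  rw [map_zero, ← eval₂_at_apply, ← eval_map, ← WeierstrassCurve.map_Ψ₃, hr₀]
  exact hr

/-- **Type III normal form with `‖b₂‖ = ‖3‖`: `E[3]` is reducible over `F`** (the unique unit root
of `Ψ₃` is `F`-rational).  Contrapositively: on the type-III rows with `E[3]` IRREDUCIBLE over `F`
one has `‖b₂‖ ≤ ‖3‖²`. [cite: SilvermanATAEC1994, IV.9.4 Step 4] [cite: Cremona1997, §3.8] -/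
theorem not_hasIrreducibleModPGaloisRep_three_of_algNorm_b₂_eq_III
    (hirr : Irreducible ((3 : ℕ) : 𝒪[F]))
    (hb₂ : algNorm F (V.baseChange (AlgebraicClosure F)).b₂ = algNorm F (3 : AlgebraicClosure F))
    (hb₄ : algNorm F (V.baseChange (AlgebraicClosure F)).b₄ = algNorm F (3 : AlgebraicClosure F))
    (hb₆ : algNorm F (V.baseChange (AlgebraicClosure F)).b₆ ≤ algNorm F (3 : AlgebraicClosure F) ^ 2)
    (hb₈ : algNorm F (V.baseChange (AlgebraicClosure F)).b₈ = algNorm F (3 : AlgebraicClosure F) ^ 2) :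
    ¬ V.HasIrreducibleModPGaloisRep 3 := by
  obtain ⟨⟨r, hr, hr1⟩, huniq⟩ :=
    exists_unique_root_Ψ₃_algNorm_eq_one_III (V.baseChange (AlgebraicClosure F)) hirr hb₂ hb₄ hb₆ hb₈
  exact not_hasIrreducibleModPGaloisRep_three_of_unique_root V (N := algNorm F) algNorm_smul hr
    fun r' hr' hN ↦ huniq r' r hr' hr (hN.trans hr1) hr1

/-- **Type III* normal form with `‖b₂‖ = ‖3‖²: `E[3]` is reducible over `F`** (the unique root of
`Ψ₃` of norm `‖3‖` is `F`-rational); contrapositively `‖b₂‖ ≤ ‖3‖³` on the irreducible III* rows.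
[cite: SilvermanATAEC1994, IV.9.4 Step 9] [cite: Cremona1997, §3.8] -/
theorem not_hasIrreducibleModPGaloisRep_three_of_algNorm_b₂_eq_IIIstar
    (hirr : Irreducible ((3 : ℕ) : 𝒪[F]))
    (hb₂ : algNorm F (V.baseChange (AlgebraicClosure F)).b₂ = algNorm F (3 : AlgebraicClosure F) ^ 2)
    (hb₄ : algNorm F (V.baseChange (AlgebraicClosure F)).b₄ = algNorm F (3 : AlgebraicClosure F) ^ 3)
    (hb₆ : algNorm F (V.baseChange (AlgebraicClosure F)).b₆ ≤ algNorm F (3 : AlgebraicClosure F) ^ 5)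
    (hb₈ : algNorm F (V.baseChange (AlgebraicClosure F)).b₈ = algNorm F (3 : AlgebraicClosure F) ^ 6) :
    ¬ V.HasIrreducibleModPGaloisRep 3 := by
  obtain ⟨⟨r, hr, hr1⟩, huniq⟩ :=
    exists_unique_root_Ψ₃_algNorm_eq_three_IIIstar (V.baseChange (AlgebraicClosure F)) hirr hb₂ hb₄
      hb₆ hb₈
  exact not_hasIrreducibleModPGaloisRep_three_of_unique_root V (N := algNorm F) algNorm_smul hr
    fun r' hr' hN ↦ huniq r' r hr' hr (hN.trans hr1) hr1

end Descent

end Literature.NumberTheory.EllipticCurves.ThreeTorsionIrreducibleShape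

/-! ## §4. The additive embedding `θ` (Serre's analytic half on the quartic twist) -/

namespace Literature.NumberTheory.EllipticCurves.ThreeTorsionIrreducibleShape

open Literature.NumberTheory.GaloisRepresentations
  Literature.NumberTheory.GaloisRepresentations.IsNonarchimedeanLocalField
  Literature.NumberTheory.EllipticCurves.ThreeTorsionReducibleShape _root_.WeierstrassCurve

variable {F : Type u} [Field F] [ValuativeRel F] [TopologicalSpace F] [IsNonarchimedeanLocalField F]

/-- `residue (x ^ m) = residue x ^ m` on the closed unit ball. [folklore] -/
private theorem residue_pow' {x : AlgebraicClosure F} (hx : algNorm F x ≤ 1) (m : ℕ) :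
    residue F (x ^ m) = residue F x ^ m := by
  induction m with
  | zero => rw [pow_zero, pow_zero, residue_one]
  | succ m ih =>
    have hxm : algNorm F (x ^ m) ≤ 1 := by rw [algNorm_pow]; exact pow_le_one₀ (algNorm_nonneg _) hx
    rw [pow_succ, residue_mul hxm hx, ih, pow_succ]

omit [ValuativeRel F] [TopologicalSpace F] [IsNonarchimedeanLocalField F] in
/-- `-(u⁻²x)/(u⁻³y) = u·(-x/y)`: the parameter `z = -x/y` of the rescaled equation `⟨u⟩ • E` is
`u` times that of `E`. [cite: SilvermanAEC2009, III.1 Table 3.1] -/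
private theorem neg_div_rescale_aux {L : Type*} [Field L] {u x y : L} (hu : u ≠ 0) (hy : y ≠ 0) :
    -(u⁻¹ ^ 2 * x) / (u⁻¹ ^ 3 * y) = u * (-x / y) := by
  field_simp

omit [ValuativeRel F] [TopologicalSpace F] [IsNonarchimedeanLocalField F] in
/-- `u a / π = (a/z₀) · (u z₀/π)`. [folklore] -/
private theorem mul_div_split_aux {L : Type*} [Field L] {z₀ π : L} (u a : L) (hz : z₀ ≠ 0) (hπ : π ≠ 0) :
    u * a / π = (a / z₀) * (u * z₀ / π) := by
  field_simp

omit [ValuativeRel F] [TopologicalSpace F] [IsNonarchimedeanLocalField F] in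
/-- `(b/z₀) · (b⁻¹/z₀⁻¹) = 1`. [folklore] -/
private theorem div_mul_inv_div_inv_aux {L : Type*} [Field L] {b z₀ : L} (hz : z₀ ≠ 0) (hb : b ≠ 0) :
    (b / z₀) * (b⁻¹ / z₀⁻¹) = 1 := by
  field_simp

set_option maxHeartbeats 800000 in
/-- **Serre's additive embedding on the quartic-twisted good model (the analytic half, both Kodaira
types at once).**  Let `F` be a `3`-adic field with uniformiser `3` and residue field `𝔽₃`,
`E = V/F` elliptic, `q = ‖3‖`, `π ∈ F̄` the chosen root of `π⁸ = 3` (the one defining the level-two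
fundamental character `ψ₂`), `k ≥ 1` an integer (`k = 1`: type III, `k = 3`: type III*).  Suppose
(i) the rescaled equation `⟨π^{2k}⟩ • E` is integral: `‖a₁‖⁴ ≤ q^k`, `‖a₂‖² ≤ q^k`, `‖a₃‖⁴ ≤ q^{3k}`,
`‖a₄‖ ≤ q^k`, `‖a₆‖² ≤ q^{3k}`; (ii) every `T = (x, y) ∈ E[3] ∖ 0` has `‖x‖⁴ = q^{2k-1}` and
`‖y‖⁸ = q^{6k-3}` (the single-slope configuration of the Newton polygon of `[3]`).  Then there is
`θ : E(F̄) → k` which on `E[3]` is additive and injective and satisfies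
`ψ₂(σ)^{2k-1} · θ(σ T) = θ(T)` for `σ` in the inertia group, i.e. `θ` is `ψ₂^{-(2k-1)}`-equivariant
(`ψ₂⁷` for `k = 1`, `ψ₂³` for `k = 3`).  Construction: on the good model `E' = ⟨u = π^{2k}⟩ • E_{F̄}`
(`w`-integral, `w = ‖·‖`) the points of `E[3]` lie in the kernel of reduction with parameter
`z' = u·z`, `z = -x/y`, of absolute value `‖π‖` exactly; `θ(T) = ι(z'(T)/π mod 𝔓)` is additive by
the first-order additivity of `z'` (`FormalGroupChart.val_zCoord_add_sub_le`, error `≤ ‖π‖²`),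
injective, and `z(σT) = σ z(T)` with `‖z⁻¹‖ = ‖π^{2k-1}‖` gives
`z(σT)/z(T) ≡ ψ₂(σ)^{-(2k-1)}` (`residue_smul_div_eq_of_algNorm_eq`, Serre's §1.7 Prop. 3).  This is
Serre, Invent. Math. 15 (1972), §1.9 Prop. 9 / §1.10 (`V_e ≅ 𝔪_e/𝔪_e⁺`, `I` acting through
`θ_{q-1}^e`) carried out on the quartic twist, the descent datum contributing `ψ₂^{∓2k}`.
[cite: SerreInventiones1972, §1.7 Prop. 3, §1.9 Prop. 9, §1.10 Prop. 10]
[cite: SilvermanAEC2009, IV.1 and Prop. VII.2.2] -/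
theorem exists_additive_equivariant_of_torsion_norms [CharZero F] (hirr : Irreducible ((3 : ℕ) : 𝒪[F]))
    (hq : residueFieldCard F = 3) (V : WeierstrassCurve F) [V.IsElliptic] (k : ℕ) (hk : 1 ≤ k)
    (h₁ : algNorm F (V.baseChange (AlgebraicClosure F)).a₁ ^ 4 ≤ algNorm F (3 : AlgebraicClosure F) ^ k)
    (h₂ : algNorm F (V.baseChange (AlgebraicClosure F)).a₂ ^ 2 ≤ algNorm F (3 : AlgebraicClosure F) ^ k)
    (h₃ : algNorm F (V.baseChange (AlgebraicClosure F)).a₃ ^ 4 ≤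
      algNorm F (3 : AlgebraicClosure F) ^ (3 * k))
    (h₄ : algNorm F (V.baseChange (AlgebraicClosure F)).a₄ ≤ algNorm F (3 : AlgebraicClosure F) ^ k)
    (h₆ : algNorm F (V.baseChange (AlgebraicClosure F)).a₆ ^ 2 ≤
      algNorm F (3 : AlgebraicClosure F) ^ (3 * k))
    (hcoord : ∀ T ∈ geomTorsion V (3 : ℕ), ∀ {x y : AlgebraicClosure F}
      {h : (V.baseChange (AlgebraicClosure F)).toAffine.Nonsingular x y},
      (T : geomPoints V) = .some x y h →
        algNorm F x ^ 4 = algNorm F (3 : AlgebraicClosure F) ^ (2 * k - 1) ∧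
          algNorm F y ^ 8 = algNorm F (3 : AlgebraicClosure F) ^ (6 * k - 3))
    {k' : Type v} [Field k'] (ι : absIntegers 𝒪[F] F ⧸ absMaximalIdeal F →+* k') :
    ∃ θ : geomPoints V → k',
      (∀ X ∈ geomTorsion V (3 : ℕ), ∀ Y ∈ geomTorsion V (3 : ℕ), θ (X + Y) = θ X + θ Y) ∧
      (∀ X ∈ geomTorsion V (3 : ℕ), θ X = 0 → X = 0) ∧
      (∀ (σ : absInertia F), ∀ X ∈ geomTorsion V (3 : ℕ),
        (fundamentalCharacter F 2 ι ((3 : ℕ) : 𝒪[F]) hirr σ : k') ^ (2 * k - 1) *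
          θ ((σ : absoluteGaloisGroup F) • X) = θ X) := by
  classical
  haveI : Fact (Nat.Prime 3) := ⟨Nat.prime_three⟩
  haveI : NeZero ((3 : ℕ) : F) := neZero_natCast_of_irreducible hirr
  set L := AlgebraicClosure F with hL
  have h3L : (3 : L) ≠ 0 := by
    have h := NeZero.ne ((3 : ℕ) : F)
    intro h0
    apply h
    apply (algebraMap F L).injective
    rw [map_natCast, map_zero]; exact_mod_cast h0
  obtain ⟨hq0, hq1⟩ : 0 < algNorm F (3 : L) ∧ algNorm F (3 : L) < 1 := by
    have h1 := algNorm_uniformizer_pos hirr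
    have h2 := algNorm_uniformizer_lt_one hirr
    rw [map_natCast] at h1 h2
    exact ⟨by simpa using h1, by simpa using h2⟩
  set q := algNorm F (3 : L) with hqdef
  set X := V.baseChange L with hX
  /- Step 0: the Kummer root `π`, `π⁸ = 3`, `ρ = ‖π‖`. -/
  have hn : 0 < residueFieldCard F ^ 2 - 1 := residueFieldCard_pow_sub_one_pos F two_ne_zero
  have hn8 : residueFieldCard F ^ 2 - 1 = 8 := by rw [hq]; norm_num
  set π : L := (kummerRoot F hn ((3 : ℕ) : 𝒪[F]) : L) with hπdef
  have hπ0 : π ≠ 0 := coe_kummerRoot_ne_zero hn hirr.ne_zero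
  have hπnorm : algNorm F π ^ (residueFieldCard F ^ 2 - 1) =
      algNorm F (algebraMap 𝒪[F] L ((3 : ℕ) : 𝒪[F])) := by
    rw [hπdef, algNorm_kummerRoot_pow]
  set ρ := algNorm F π with hρdef
  have hρ8 : ρ ^ 8 = q := by
    rw [← hn8, hρdef, hπnorm, map_natCast, Nat.cast_ofNat]
  have hρpos : 0 < ρ := algNorm_pos_iff.mpr hπ0
  have hρ1 : ρ < 1 := by
    by_contra h
    have : 1 ≤ ρ ^ 8 := one_le_pow₀ (not_lt.mp h)
    rw [hρ8] at this
    exact absurd hq1 (not_lt.mpr this)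
  have hρne : ∀ m : ℕ, ρ ^ m ≠ 0 := fun m ↦ (pow_pos hρpos m).ne'
  have hπpow : ∀ m : ℕ, algNorm F (π ^ m) = ρ ^ m := fun m ↦ algNorm_pow π m
  have hπm0 : ∀ m : ℕ, π ^ m ≠ 0 := fun m ↦ pow_ne_zero m hπ0
  -- `4`-th and `8`-th roots
  have hpow_inj : ∀ {a b : ℝ} (m : ℕ), m ≠ 0 → 0 ≤ a → 0 ≤ b → a ^ m = b ^ m → a = b :=
    fun m hm ha hb h ↦ (pow_left_inj₀ ha hb hm).mp h
  /- Step 1: coordinates of the points of `E[3] ∖ 0`: `‖x‖ = ρ^{4k-2}`, `‖y‖ = ρ^{6k-3}`. -/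
  have hxy : ∀ T ∈ geomTorsion V (3 : ℕ), ∀ {x y : L} {h : X.toAffine.Nonsingular x y},
      (T : geomPoints V) = .some x y h →
        algNorm F x = ρ ^ (4 * k - 2) ∧ algNorm F y = ρ ^ (6 * k - 3) ∧ x ≠ 0 ∧ y ≠ 0 := by
    intro T hT x y h hTxy
    obtain ⟨hx4, hy8⟩ := hcoord T hT hTxy
    have hx : algNorm F x = ρ ^ (4 * k - 2) := by
      refine hpow_inj 4 four_ne_zero (algNorm_nonneg _) (pow_nonneg hρpos.le _) ?_
      rw [hx4, ← hρ8, ← pow_mul, ← pow_mul]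
      congr 1; omega
    have hy : algNorm F y = ρ ^ (6 * k - 3) := by
      refine hpow_inj 8 (by norm_num) (algNorm_nonneg _) (pow_nonneg hρpos.le _) ?_
      rw [hy8, ← hρ8, ← pow_mul, ← pow_mul]
      congr 1; omega
    refine ⟨hx, hy, ?_, ?_⟩
    · intro h0; rw [h0, algNorm_zero] at hx; exact hρne _ hx.symm
    · intro h0; rw [h0, algNorm_zero] at hy; exact hρne _ hy.symm
  /- Step 2: the rescaled model `V' = ⟨u = π^{2k}⟩ • X` and its integrality. -/
  set u : L := π ^ (2 * k) with hudef
  have hu0 : u ≠ 0 := hπm0 _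
  have hunorm : algNorm F u = ρ ^ (2 * k) := hπpow _
  set C : VariableChange L := ⟨Units.mk0 u hu0, 0, 0, 0⟩ with hCdef
  have hCu : ((C.u⁻¹ : Lˣ) : L) = u⁻¹ := by rw [Units.val_inv_eq_inv_val, hCdef, Units.val_mk0]
  set V' : WeierstrassCurve L := C • X with hV'
  have ha₁ : V'.a₁ = u⁻¹ * X.a₁ := by
    rw [hV', variableChange_a₁, hCu]; simp [hCdef]
  have ha₂ : V'.a₂ = u⁻¹ ^ 2 * X.a₂ := by
    rw [hV', variableChange_a₂, hCu]; simp [hCdef]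
  have ha₃ : V'.a₃ = u⁻¹ ^ 3 * X.a₃ := by
    rw [hV', variableChange_a₃, hCu]; simp [hCdef]
  have ha₄ : V'.a₄ = u⁻¹ ^ 4 * X.a₄ := by
    rw [hV', variableChange_a₄, hCu]; simp [hCdef]
  have ha₆ : V'.a₆ = u⁻¹ ^ 6 * X.a₆ := by
    rw [hV', variableChange_a₆, hCu]; simp [hCdef]
  -- the valuation `w = ‖·‖` on `F̄` with values in `ℝ≥0`
  let w : Valuation L ℝ≥0 :=
    { toFun := fun x ↦ ⟨algNorm F x, algNorm_nonneg x⟩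
      map_zero' := Subtype.ext algNorm_zero
      map_one' := Subtype.ext algNorm_one
      map_mul' := fun x y ↦ Subtype.ext (algNorm_mul x y)
      map_add_le_max' := fun x y ↦ by
        rw [le_max_iff]
        rcases le_max_iff.mp (algNorm_add_le x y) with h | h
        · left; exact_mod_cast h
        · right; exact_mod_cast h }
  have hw : ∀ x, ((w x : ℝ≥0) : ℝ) = algNorm F x := fun x ↦ rfl
  have hwle : ∀ {a b : L}, w a ≤ w b ↔ algNorm F a ≤ algNorm F b := fun {a b} ↦ by
    rw [← NNReal.coe_le_coe, hw, hw]
  have hwlt : ∀ {a b : L}, w a < w b ↔ algNorm F a < algNorm F b := fun {a b} ↦ by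
    rw [← NNReal.coe_lt_coe, hw, hw]
  have hw1 : ∀ {a : L}, w a ≤ 1 ↔ algNorm F a ≤ 1 := fun {a} ↦ by
    rw [← NNReal.coe_le_coe, hw, NNReal.coe_one]
  have hw1' : ∀ {a : L}, 1 < w a ↔ 1 < algNorm F a := fun {a} ↦ by
    rw [← NNReal.coe_lt_coe, hw, NNReal.coe_one]
  -- integrality of `V'`
  have hmem : ∀ {a : L}, algNorm F a ≤ 1 → ∃ r : w.integer, (algebraMap w.integer L) r = a :=
    fun {a} ha ↦ ⟨⟨a, (Valuation.mem_integer_iff _ _).mpr (hw1.mpr ha)⟩, rfl⟩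
  -- `‖a_i‖ ≤ ρ^{2ki}`
  have hle_of_pow : ∀ {a : ℝ} {e : ℕ} (m : ℕ), m ≠ 0 → 0 ≤ a → a ^ m ≤ (ρ ^ e) ^ m → a ≤ ρ ^ e :=
    fun m hm _ h ↦ le_of_pow_le_pow_left₀ hm (pow_nonneg hρpos.le _) h
  have n₁ : algNorm F X.a₁ ≤ ρ ^ (2 * k) := by
    refine hle_of_pow 4 four_ne_zero (algNorm_nonneg _) ?_
    rw [← pow_mul, show 2 * k * 4 = 8 * k by ring, pow_mul, hρ8]; exact h₁
  have n₂ : algNorm F X.a₂ ≤ ρ ^ (2 * k * 2) := by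
    refine hle_of_pow 2 two_ne_zero (algNorm_nonneg _) ?_
    rw [← pow_mul, show 2 * k * 2 * 2 = 8 * k by ring, pow_mul, hρ8]; exact h₂
  have n₃ : algNorm F X.a₃ ≤ ρ ^ (2 * k * 3) := by
    refine hle_of_pow 4 four_ne_zero (algNorm_nonneg _) ?_
    rw [← pow_mul, show 2 * k * 3 * 4 = 8 * (3 * k) by ring, pow_mul, hρ8]; exact h₃
  have n₄ : algNorm F X.a₄ ≤ ρ ^ (2 * k * 4) := by
    rw [show 2 * k * 4 = 8 * k by ring, pow_mul, hρ8]; exact h₄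
  have n₆ : algNorm F X.a₆ ≤ ρ ^ (2 * k * 6) := by
    refine hle_of_pow 2 two_ne_zero (algNorm_nonneg _) ?_
    rw [← pow_mul, show 2 * k * 6 * 2 = 8 * (3 * k) by ring, pow_mul, hρ8]; exact h₆
  have hscaled : ∀ {a : L} (i : ℕ), algNorm F a ≤ ρ ^ (2 * k * i) → algNorm F (u⁻¹ ^ i * a) ≤ 1 := by
    intro a i ha
    rw [algNorm_mul, algNorm_pow, algNorm_inv, hunorm, inv_pow, ← pow_mul]
    rw [inv_mul_le_iff₀ (pow_pos hρpos _), mul_one]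
    exact ha
  haveI hint : V'.IsIntegral w.integer := by
    refine isIntegral_of_exists_lift _ (hmem ?_) (hmem ?_) (hmem ?_) (hmem ?_) (hmem ?_)
    · rw [ha₁, ← pow_one u⁻¹]; exact hscaled 1 (by rw [mul_one]; exact n₁)
    · rw [ha₂]; exact hscaled 2 n₂
    · rw [ha₃]; exact hscaled 3 n₃
    · rw [ha₄]; exact hscaled 4 n₄
    · rw [ha₆]; exact hscaled 6 n₆
  /- Step 3: the points of `E[3]` on `V'`: kernel of reduction, `‖z'‖ = ρ`. -/
  let A : geomPoints V →+ V'.toAffine.Point := (VariableChange.pointEquiv X C).toAddMonoidHom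
  have hAdef : ∀ P : geomPoints V, A P = VariableChange.pointEquiv X C P := fun P ↦ rfl
  have hAinj : Function.Injective A := (VariableChange.pointEquiv X C).injective
  have htoX : ∀ x : L, C.toX x = u⁻¹ ^ 2 * x := fun x ↦ by
    show ((C.u⁻¹ : Lˣ) : L) ^ 2 * (x - C.r) = _
    rw [hCu]; simp [hCdef]
  have htoY : ∀ x y : L, C.toY x y = u⁻¹ ^ 3 * y := fun x y ↦ by
    show ((C.u⁻¹ : Lˣ) : L) ^ 3 * (y - C.s * (x - C.r) - C.t) = _
    rw [hCu]; simp [hCdef]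
  have hAsome : ∀ {x y : L} (h : X.toAffine.Nonsingular x y),
      A (.some x y h) = .some (C.toX x) (C.toY x y) ((VariableChange.nonsingular_iff X C x y).mpr h) :=
    fun h ↦ by rw [hAdef, VariableChange.pointEquiv_some]
  -- `-(u⁻² x)/(u⁻³ y) = u · (-x/y)`
  have hzid : ∀ {x y : L}, y ≠ 0 → -(u⁻¹ ^ 2 * x) / (u⁻¹ ^ 3 * y) = u * (-x / y) :=
    fun hy ↦ neg_div_rescale_aux hu0 hy
  -- kernel membership and the size of `z'`
  have hker : ∀ T ∈ geomTorsion V (3 : ℕ), A (T : geomPoints V) ∈ FormalGroupChart.kernel w V' := by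
    intro T hT
    rcases hTc : (T : geomPoints V) with _ | ⟨x, y, h⟩
    · have h0 : A (0 : geomPoints V) = 0 := map_zero A
      exact (h0 ▸ (zero_mem (FormalGroupChart.kernel w V') :) :)
    · obtain ⟨hx, -, -, -⟩ := hxy T hT hTc
      rw [hAsome h, FormalGroupChart.some_mem_kernel_iff, htoX, hw1', algNorm_mul, algNorm_pow,
        algNorm_inv, hunorm, hx, inv_pow, ← pow_mul]
      rw [show ρ ^ (4 * k - 2) = ρ ^ (2 * k * 2) * (ρ ^ 2)⁻¹ by
        rw [eq_mul_inv_iff_mul_eq₀ (hρne 2), ← pow_add]; congr 1; omega]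
      rw [← mul_assoc, inv_mul_cancel₀ (hρne _), one_mul, one_lt_inv_iff₀]
      exact ⟨pow_pos hρpos 2, pow_lt_one₀ hρpos.le hρ1 two_ne_zero⟩
  have hzA : ∀ T ∈ geomTorsion V (3 : ℕ), ∀ {x y : L} {h : X.toAffine.Nonsingular x y},
      (T : geomPoints V) = .some x y h → (A (T : geomPoints V)).zCoord = u * (-x / y) := by
    intro T hT x y h hTc
    obtain ⟨-, -, hx0, hy0⟩ := hxy T hT hTc
    rw [hTc, hAsome h, WeierstrassCurve.Affine.Point.zCoord_some, htoX, htoY]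
    exact hzid hy0
  have hznorm : ∀ T ∈ geomTorsion V (3 : ℕ), T ≠ 0 → algNorm F (A (T : geomPoints V)).zCoord = ρ := by
    intro T hT hT0
    rcases hTc : (T : geomPoints V) with _ | ⟨x, y, h⟩
    · exact (hT0 (by rw [hTc]; rfl)).elim
    · obtain ⟨hx, hy, hx0, hy0⟩ := hxy T hT hTc
      have hρid : ρ ^ (2 * k) * ρ ^ (4 * k - 2) = ρ * ρ ^ (6 * k - 3) := by
        rw [← pow_add, ← pow_succ']; congr 1; omega
      rw [← hTc, hzA T hT hTc, algNorm_mul, hunorm, algNorm_div, algNorm_neg, hx, hy, mul_div_assoc',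
        div_eq_iff (hρne _), hρid]
  have hznorm_le : ∀ T ∈ geomTorsion V (3 : ℕ), algNorm F (A (T : geomPoints V)).zCoord ≤ ρ := by
    intro T hT
    by_cases hT0 : T = 0
    · rw [hT0, map_zero, WeierstrassCurve.Affine.Point.zCoord_zero, algNorm_zero]; exact hρpos.le
    · exact (hznorm T hT hT0).le
  have hwz_le : ∀ T ∈ geomTorsion V (3 : ℕ), w (A (T : geomPoints V)).zCoord ≤ w π := by
    intro T hT; rw [hwle]; exact hznorm_le T hT
  have hρn0 : algNorm F π ≠ 0 := hρpos.ne'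
  have hnorm_div : ∀ T ∈ geomTorsion V (3 : ℕ), algNorm F ((A (T : geomPoints V)).zCoord / π) ≤ 1 := by
    intro T hT
    rw [algNorm_div, div_le_one hρpos]; exact hznorm_le T hT
  /- Step 4: `θ(T) = ι(z'(T)/π mod 𝔓)`. -/
  let θ : geomPoints V → k' := fun T ↦ ι (residue F ((A T).zCoord / π))
  have hθdef : ∀ T, θ T = ι (residue F ((A T).zCoord / π)) := fun T ↦ rfl
  have hθ0 : θ 0 = 0 := by
    rw [hθdef, map_zero, WeierstrassCurve.Affine.Point.zCoord_zero, zero_div, residue_zero, ι.map_zero]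
  -- additivity: `z'` is additive to first order on `E'₁`, the error being `≤ ‖π‖² < ‖π‖`
  have hθadd : ∀ T ∈ geomTorsion V (3 : ℕ), ∀ T' ∈ geomTorsion V (3 : ℕ), θ (T + T') = θ T + θ T' := by
    intro T hT T' hT'
    rw [hθdef, hθdef, hθdef, ← ι.map_add, map_add]
    congr 1
    set err := (A T + A T').zCoord - (A T).zCoord - (A T').zCoord with herr
    have herr_le : w err ≤ w π ^ 2 :=
      (FormalGroupChart.val_zCoord_add_sub_le (hker T hT) (hker T' hT')).trans
        (pow_le_pow_left' (max_le (hwz_le T hT) (hwz_le T' hT')) 2)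
    have herr_le' : algNorm F err ≤ ρ ^ 2 := by
      have h := herr_le
      rw [← NNReal.coe_le_coe, NNReal.coe_pow, hw, hw] at h
      exact h
    have herr_div : algNorm F (err / π) < 1 := by
      rw [algNorm_div, div_lt_one hρpos]
      calc algNorm F err ≤ ρ ^ 2 := herr_le'
        _ < ρ := by rw [sq]; exact mul_lt_of_lt_one_left hρpos hρ1
    have hsplit : (A T + A T').zCoord / π = ((A T).zCoord / π + (A T').zCoord / π) + err / π := by
      rw [herr]; ring
    have hsum_le : algNorm F ((A T).zCoord / π + (A T').zCoord / π) ≤ 1 :=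
      (algNorm_add_le _ _).trans (max_le (hnorm_div T hT) (hnorm_div T' hT'))
    rw [hsplit, residue_add hsum_le herr_div.le, residue_add (hnorm_div T hT) (hnorm_div T' hT'),
      (residue_eq_zero_iff herr_div.le).mpr herr_div, add_zero]
  -- injectivity
  have hθinj : ∀ T ∈ geomTorsion V (3 : ℕ), θ T = 0 → T = 0 := by
    intro T hT hθT
    by_contra hT0
    have h1 : algNorm F ((A T).zCoord / π) = 1 := by
      rw [algNorm_div, hznorm T hT hT0, div_self hρn0]
    have h2 : residue F ((A T).zCoord / π) ≠ 0 := by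
      intro h0
      rw [residue_eq_zero_iff h1.le, h1] at h0
      exact lt_irrefl _ h0
    rw [hθdef] at hθT
    exact h2 (ModPGaloisRep.residueEmbedding_injective ι (by rw [ι.map_zero]; exact hθT))
  /- Step 5: equivariance `ψ₂(σ)^{2k-1} θ(σT) = θ(T)`. -/
  -- `ψ₂(σ) = ι(σπ/π mod 𝔓)`
  have hψ : ∀ σ : absInertia F,
      ((fundamentalCharacter F 2 ι ((3 : ℕ) : 𝒪[F]) hirr σ : k'ˣ) : k') =
        ι (residue F ((σ : absoluteGaloisGroup F) • π / π)) := by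
    intro σ
    rw [fundamentalCharacter_of_ne_zero F two_ne_zero,
      coe_kummerCharacter_eq_residue_smul_div hn hirr.ne_zero ι σ (z := π) hπnorm]
  have hσππ : ∀ σ : absInertia F, algNorm F ((σ : absoluteGaloisGroup F) • π / π) ≤ 1 :=
    fun σ ↦ (algNorm_smul_div_self _ hπ0).le
  have hθsmul : ∀ (σ : absInertia F), ∀ T ∈ geomTorsion V (3 : ℕ),
      (fundamentalCharacter F 2 ι ((3 : ℕ) : 𝒪[F]) hirr σ : k') ^ (2 * k - 1) *
        θ ((σ : absoluteGaloisGroup F) • T) = θ T := by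
    intro σ T hT
    by_cases hT0 : T = 0
    · subst hT0; rw [smul_zero, hθ0, mul_zero]
    obtain ⟨x, y, h, hTc⟩ : ∃ (x y : L) (h : X.toAffine.Nonsingular x y),
        (T : geomPoints V) = .some x y h := by
      rcases hT' : (T : geomPoints V) with _ | ⟨x, y, h⟩
      · exact (hT0 (by rw [hT']; rfl)).elim
      · exact ⟨x, y, h, rfl⟩
    obtain ⟨hx, hy, hx0, hy0⟩ := hxy T hT hTc
    -- the conjugate point and its parameter
    set g : absoluteGaloisGroup F := (σ : absoluteGaloisGroup F) with hg
    set σE : L →ₐ[F] L := ((absoluteGaloisGroup.toAlgEquiv F g : L ≃ₐ[F] L) : L →ₐ[F] L) with hσE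
    have hσEapp : ∀ t : L, σE t = g • t := fun t ↦ rfl
    have hgT : ((g • T : geomPoints V)) = WeierstrassCurve.Affine.Point.map σE (.some x y h) := by
      rw [hTc]; rfl
    rw [WeierstrassCurve.Affine.Point.map_some] at hgT
    have hgTmem : g • T ∈ geomTorsion V (3 : ℕ) := smul_mem_torsionBy g hT
    set z₀ : L := -x / y with hz₀
    have hz₀0 : z₀ ≠ 0 := div_ne_zero (neg_ne_zero.mpr hx0) hy0
    have hzT : (A T).zCoord = u * z₀ := hzA T hT hTc
    have hgz₀ : g • z₀ = -(g • x) / (g • y) := by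
      rw [hz₀, absoluteGaloisGroup.smul_def, absoluteGaloisGroup.smul_def, absoluteGaloisGroup.smul_def,
        map_div₀, map_neg]
    have hzgT : (A (g • T)).zCoord = u * (g • z₀) := by
      rw [hzA (g • T) hgTmem hgT, hgz₀, hσEapp, hσEapp]
    -- `z(σT)/π = (σz₀/z₀) · (z(T)/π)`
    have hsplit : (A (g • T)).zCoord / π = (g • z₀ / z₀) * ((A T).zCoord / π) := by
      rw [hzgT, hzT]; exact mul_div_split_aux u (g • z₀) hz₀0 hπ0
    have hn1 : algNorm F (g • z₀ / z₀) ≤ 1 := (algNorm_smul_div_self g hz₀0).le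
    have hθgT : θ (g • T) = ι (residue F (g • z₀ / z₀)) * θ T := by
      rw [hθdef, hθdef, hsplit, residue_mul hn1 (hnorm_div T hT), ι.map_mul]
    -- the character: `ι(σ z₁/z₁ mod 𝔓) = ψ₂(σ)^{2k-1}` for `z₁ = z₀⁻¹`, `‖z₁‖ = ‖π^{2k-1}‖`
    have hz₁0 : z₀⁻¹ ≠ 0 := inv_ne_zero hz₀0
    have hz₁norm : algNorm F z₀⁻¹ = algNorm F (π ^ (2 * k - 1)) := by
      rw [algNorm_inv, hz₀, algNorm_div, algNorm_neg, hx, hy, hπpow, inv_div,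
        div_eq_iff (hρne _), ← pow_add]
      congr 1; omega
    have hgpow : g • π ^ (2 * k - 1) / π ^ (2 * k - 1) = (g • π / π) ^ (2 * k - 1) := by
      rw [absoluteGaloisGroup.smul_def, map_pow, ← absoluteGaloisGroup.smul_def, div_pow]
    have hchar : ι (residue F (g • z₀⁻¹ / z₀⁻¹)) =
        ((fundamentalCharacter F 2 ι ((3 : ℕ) : 𝒪[F]) hirr σ : k'ˣ) : k') ^ (2 * k - 1) := by
      rw [residue_smul_div_eq_of_algNorm_eq σ.2 hz₁0 hz₁norm, hgpow, residue_pow' (hσππ σ), map_pow,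
        hψ σ]
    -- `(σz₀/z₀)(σz₁/z₁) = 1`
    have hgz₀0 : g • z₀ ≠ 0 := by
      rw [absoluteGaloisGroup.smul_def]; exact (_root_.map_ne_zero _).mpr hz₀0
    have hgz₁ : g • z₀⁻¹ = (g • z₀)⁻¹ := by
      rw [absoluteGaloisGroup.smul_def, map_inv₀, ← absoluteGaloisGroup.smul_def]
    have hprod : (g • z₀ / z₀) * (g • z₀⁻¹ / z₀⁻¹) = 1 := by
      rw [hgz₁]; exact div_mul_inv_div_inv_aux hz₀0 hgz₀0
    have hn1' : algNorm F (g • z₀⁻¹ / z₀⁻¹) ≤ 1 := (algNorm_smul_div_self g hz₁0).le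
    have hone : ((fundamentalCharacter F 2 ι ((3 : ℕ) : 𝒪[F]) hirr σ : k'ˣ) : k') ^ (2 * k - 1) *
        ι (residue F (g • z₀ / z₀)) = 1 := by
      rw [← hchar, ← ι.map_mul, ← residue_mul hn1' hn1, mul_comm, hprod, residue_one, ι.map_one]
    rw [hθgT, ← mul_assoc, hone, one_mul]
  exact ⟨θ, hθadd, hθinj, hθsmul⟩

end Literature.NumberTheory.EllipticCurves.ThreeTorsionIrreducibleShape

/-! ## §5. The two Kodaira types: `θ` on the type-III / III* Tate normal forms, and the local shapes -/

namespace Literature.NumberTheory.EllipticCurves.ThreeTorsionIrreducibleShape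

open Literature.NumberTheory.GaloisRepresentations
  Literature.NumberTheory.GaloisRepresentations.IsNonarchimedeanLocalField
  Literature.NumberTheory.GaloisRepresentations.ModPGaloisRep
  Literature.NumberTheory.EllipticCurves.ThreeTorsionReducibleShape _root_.WeierstrassCurve

variable {F : Type u} [Field F] [ValuativeRel F] [TopologicalSpace F] [IsNonarchimedeanLocalField F]

section NormalForms

variable (X : WeierstrassCurve (AlgebraicClosure F))

omit [ValuativeRel F] [TopologicalSpace F] [IsNonarchimedeanLocalField F] in
/-- `‖a + b‖ⁿ < c` if `‖a‖ⁿ < c` and `‖b‖ⁿ < c`. [folklore] -/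
private theorem algNorm_add_pow_lt [ValuativeRel F] [TopologicalSpace F] [IsNonarchimedeanLocalField F]
    {a b : AlgebraicClosure F} {c : ℝ} (n : ℕ)
    (ha : algNorm F a ^ n < c) (hb : algNorm F b ^ n < c) : algNorm F (a + b) ^ n < c := by
  rcases le_total (algNorm F b) (algNorm F a) with h | h
  · calc algNorm F (a + b) ^ n ≤ algNorm F a ^ n :=
          pow_le_pow_left₀ (algNorm_nonneg _) ((algNorm_add_le a b).trans (max_le le_rfl h)) n
      _ < c := ha
  · calc algNorm F (a + b) ^ n ≤ algNorm F b ^ n :=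
          pow_le_pow_left₀ (algNorm_nonneg _) ((algNorm_add_le a b).trans (max_le h le_rfl)) n
      _ < c := hb

/-- `‖b‖ ∈ ‖3‖^ℤ`, `‖b‖ ≤ ‖3‖ᵐ` and `‖b‖ ≠ ‖3‖ᵐ` give `‖b‖ ≤ ‖3‖ᵐ⁺¹`. [folklore] -/
private theorem algNorm_le_pow_succ_of_ne (hirr : Irreducible ((3 : ℕ) : 𝒪[F]))
    {b : AlgebraicClosure F} {n : ℤ} {m : ℕ}
    (hn : algNorm F b = algNorm F (3 : AlgebraicClosure F) ^ n)
    (hle : algNorm F b ≤ algNorm F (3 : AlgebraicClosure F) ^ m)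
    (hne : algNorm F b ≠ algNorm F (3 : AlgebraicClosure F) ^ m) :
    algNorm F b ≤ algNorm F (3 : AlgebraicClosure F) ^ (m + 1) := by
  obtain ⟨hq0, hq1⟩ := algNorm_three_pos_lt_one hirr
  rw [hn] at hle hne ⊢
  rw [← zpow_natCast] at hle hne ⊢
  have h1 : (m : ℤ) ≤ n := (zpow_le_zpow_iff_right_of_lt_one₀ hq0 hq1).mp hle
  have h2 : (m : ℤ) ≠ n := fun h ↦ hne (by rw [h])
  exact (zpow_le_zpow_iff_right_of_lt_one₀ hq0 hq1).mpr (by push_cast; omega)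

/-- **`‖y‖` at a point of `E[3]`** : on the curve `Ψ₂²(x) = (2y + a₁x + a₃)²`
(`eval_Ψ₂Sq_eq_sq_of_equation`), so if `‖Ψ₂²(x)‖⁴ = c` dominates `‖a₁x‖⁸, ‖a₃‖⁸ < c` then
`‖y‖⁸ = c` (`‖2‖ = 1`). [cite: SilvermanAEC2009, III.2.3 (d) and Ex. 3.7] -/
theorem algNorm_y_pow_eight_eq (hirr : Irreducible ((3 : ℕ) : 𝒪[F])) {x y : AlgebraicClosure F}
    (heq : X.toAffine.Equation x y) {c : ℝ} (hΨ₂ : algNorm F (X.Ψ₂Sq.eval x) ^ 4 = c)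
    (ha₁ : algNorm F (X.a₁ * x) ^ 8 < c) (ha₃ : algNorm F X.a₃ ^ 8 < c) :
    algNorm F y ^ 8 = c := by
  have hsq := X.eval_Ψ₂Sq_eq_sq_of_equation heq
  set A := y - X.toAffine.negY x y with hA
  have hA8 : algNorm F A ^ 8 = c := by
    rw [← hΨ₂, hsq, algNorm_pow, ← pow_mul]
  have h2y : (2 : AlgebraicClosure F) * y = A + -(X.a₁ * x + X.a₃) := by
    rw [hA, Affine.negY]; ring
  have hB : algNorm F (-(X.a₁ * x + X.a₃)) < algNorm F A := by
    rw [algNorm_neg]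
    refine lt_of_pow_lt_pow_left₀ 8 (algNorm_nonneg _) ?_
    rw [hA8]; exact algNorm_add_pow_lt 8 ha₁ ha₃
  have h2 : algNorm F ((2 : AlgebraicClosure F) * y) = algNorm F A := by
    rw [h2y]; exact algNorm_add_eq_left hB
  rw [algNorm_mul, algNorm_two hirr, one_mul] at h2
  rw [h2, hA8]

end NormalForms

section Wrappers

variable [CharZero F] (V : WeierstrassCurve F) [V.IsElliptic]

omit [ValuativeRel F] [TopologicalSpace F] [IsNonarchimedeanLocalField F] [CharZero F] [V.IsElliptic] in
/-- `b₂(E_{F̄}) = b₂(E)` in `F̄`. [folklore] -/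
private theorem baseChange_b₂_eq :
    (V.baseChange (AlgebraicClosure F)).b₂ = algebraMap F (AlgebraicClosure F) V.b₂ := by
  rw [WeierstrassCurve.baseChange, map_b₂]

/-- **`θ` on a type-III Tate normal form with `E[3]` irreducible over `F`** (`‖aᵢ‖ ≤ ‖3‖` for
`i ≤ 4`, `‖a₆‖ ≤ ‖3‖²`, `‖Δ‖ = ‖3‖³`): there is `θ : E(F̄) → k` additive and injective on `E[3]`
with `ψ₂(σ) θ(σT) = θ(T)` on inertia (i.e. `θ(σT) = ψ₂(σ)⁷ θ(T)`).  Irreducibility forces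
`‖b₂‖ ≤ ‖3‖²` (`not_hasIrreducibleModPGaloisRep_three_of_algNorm_b₂_eq_III`), whence the
single-slope configuration `‖x‖⁴ = ‖3‖`, `‖y‖⁸ = ‖3‖³` on `E[3] ∖ 0`, and
`exists_additive_equivariant_of_torsion_norms` applies with `k = 1`.
[cite: SerreInventiones1972, §1.9 Prop. 9, §1.10, §1.11] [cite: ConradDiamondTaylor1999, §7.2, proof of Thm. 7.2.1 (p. 553)]
[cite: SilvermanATAEC1994, IV.9.4 Step 4 and Table 4.1 (type III)] -/
theorem exists_additive_equivariant_of_tateNormalForm_III (hirr : Irreducible ((3 : ℕ) : 𝒪[F]))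
    (hq : residueFieldCard F = 3)
    (h₁ : algNorm F (V.baseChange (AlgebraicClosure F)).a₁ ≤ algNorm F (3 : AlgebraicClosure F))
    (h₂ : algNorm F (V.baseChange (AlgebraicClosure F)).a₂ ≤ algNorm F (3 : AlgebraicClosure F))
    (h₃ : algNorm F (V.baseChange (AlgebraicClosure F)).a₃ ≤ algNorm F (3 : AlgebraicClosure F))
    (h₄ : algNorm F (V.baseChange (AlgebraicClosure F)).a₄ ≤ algNorm F (3 : AlgebraicClosure F))
    (h₆ : algNorm F (V.baseChange (AlgebraicClosure F)).a₆ ≤ algNorm F (3 : AlgebraicClosure F) ^ 2)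
    (hΔ : algNorm F (V.baseChange (AlgebraicClosure F)).Δ = algNorm F (3 : AlgebraicClosure F) ^ 3)
    (hIrr : V.HasIrreducibleModPGaloisRep 3)
    {k' : Type v} [Field k'] (ι : absIntegers 𝒪[F] F ⧸ absMaximalIdeal F →+* k') :
    ∃ θ : geomPoints V → k',
      (∀ X ∈ geomTorsion V (3 : ℕ), ∀ Y ∈ geomTorsion V (3 : ℕ), θ (X + Y) = θ X + θ Y) ∧
      (∀ X ∈ geomTorsion V (3 : ℕ), θ X = 0 → X = 0) ∧
      (∀ (σ : absInertia F), ∀ X ∈ geomTorsion V (3 : ℕ),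
        (fundamentalCharacter F 2 ι ((3 : ℕ) : 𝒪[F]) hirr σ : k') *
          θ ((σ : absoluteGaloisGroup F) • X) = θ X) := by
  obtain ⟨hq0, hq1⟩ := algNorm_three_pos_lt_one hirr
  set L := AlgebraicClosure F
  set X := V.baseChange L with hX
  set q := algNorm F (3 : L) with hqdef
  have hqle : ∀ {m n : ℕ}, m ≤ n → q ^ n ≤ q ^ m := fun h ↦ pow_le_pow_of_le_one hq0.le hq1.le h
  have hqlt : ∀ {m n : ℕ}, m < n → q ^ n < q ^ m := fun h ↦ pow_lt_pow_right_of_lt_one₀ hq0 hq1 h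
  obtain ⟨hb₂, hb₄, hb₆, hb₈⟩ := algNorm_b_of_tateNormalForm_III X hirr h₁ h₂ h₃ h₄ h₆ hΔ
  -- irreducibility: `‖b₂‖ ≤ q²`
  have hb₂' : algNorm F X.b₂ ≤ q ^ 2 := by
    have hXb : X.b₂ = algebraMap F L V.b₂ := baseChange_b₂_eq V
    by_cases hb0 : V.b₂ = 0
    · rw [hXb, hb0, map_zero, algNorm_zero]; exact pow_nonneg hq0.le 2
    · obtain ⟨n, hn⟩ := exists_algNorm_algebraMap_eq_zpow hirr hb0
      rw [map_natCast, Nat.cast_ofNat, ← hXb] at hn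
      refine algNorm_le_pow_succ_of_ne hirr hn (by rw [pow_one]; exact hb₂) fun h1 ↦ ?_
      rw [pow_one] at h1
      exact not_hasIrreducibleModPGaloisRep_three_of_algNorm_b₂_eq_III V hirr h1 hb₄ hb₆ hb₈ hIrr
  -- the single-slope configuration on `E[3] ∖ 0`
  have hcoord : ∀ T ∈ geomTorsion V (3 : ℕ), ∀ {x y : L} {h : X.toAffine.Nonsingular x y},
      (T : geomPoints V) = .some x y h →
        algNorm F x ^ 4 = q ^ (2 * 1 - 1) ∧ algNorm F y ^ 8 = q ^ (6 * 1 - 3) := by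
    intro T hT x y h hTc
    have hΨ : X.Ψ₃.eval x = 0 :=
      V.eval_divisionPolynomial_three_eq_zero_of_eq_some (T := ⟨T, hT⟩) hTc
    have hx : algNorm F x ^ 4 = q := algNorm_root_Ψ₃_pow_four_III X hirr hb₂' hb₄.le hb₆ hb₈ hΨ
    have hx8 : algNorm F x ^ 8 = q ^ 2 := by rw [show (8 : ℕ) = 4 * 2 from rfl, pow_mul, hx]
    have ha₁x : algNorm F (X.a₁ * x) ^ 8 < q ^ 3 := by
      rw [algNorm_mul, mul_pow, hx8]
      calc algNorm F X.a₁ ^ 8 * q ^ 2 ≤ q ^ 8 * q ^ 2 :=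
            mul_le_mul_of_nonneg_right (pow_le_pow_left₀ (algNorm_nonneg _) h₁ 8) (pow_nonneg hq0.le 2)
        _ = q ^ 10 := by ring
        _ < q ^ 3 := hqlt (by norm_num)
    have ha₃' : algNorm F X.a₃ ^ 8 < q ^ 3 :=
      lt_of_le_of_lt (pow_le_pow_left₀ (algNorm_nonneg _) h₃ 8) (hqlt (by norm_num))
    have hy := algNorm_y_pow_eight_eq X hirr h.left
      (algNorm_eval_Ψ₂Sq_pow_four_III X hirr hb₂' hb₄.le hb₆ hx) ha₁x ha₃'
    exact ⟨by rw [show 2 * 1 - 1 = 1 from rfl, pow_one]; exact hx, hy⟩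
  have g₁ : algNorm F X.a₁ ^ 4 ≤ q ^ 1 :=
    (pow_le_pow_left₀ (algNorm_nonneg _) h₁ 4).trans (hqle (show 1 ≤ 4 by norm_num))
  have g₂ : algNorm F X.a₂ ^ 2 ≤ q ^ 1 :=
    (pow_le_pow_left₀ (algNorm_nonneg _) h₂ 2).trans (hqle (show 1 ≤ 2 by norm_num))
  have g₃ : algNorm F X.a₃ ^ 4 ≤ q ^ (3 * 1) :=
    (pow_le_pow_left₀ (algNorm_nonneg _) h₃ 4).trans (hqle (show 3 * 1 ≤ 4 by norm_num))
  have g₄ : algNorm F X.a₄ ≤ q ^ 1 := by rw [pow_one]; exact h₄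
  have g₆ : algNorm F X.a₆ ^ 2 ≤ q ^ (3 * 1) :=
    (pow_le_pow_left₀ (algNorm_nonneg _) h₆ 2).trans
      (by rw [← pow_mul]; exact hqle (show 3 * 1 ≤ 2 * 2 by norm_num))
  obtain ⟨θ, hadd, hinj, hsmul⟩ := exists_additive_equivariant_of_torsion_norms hirr hq V 1 le_rfl
    g₁ g₂ g₃ g₄ g₆ hcoord ι
  refine ⟨θ, hadd, hinj, fun σ T hT ↦ ?_⟩
  have h := hsmul σ T hT
  rwa [show 2 * 1 - 1 = 1 from rfl, pow_one] at h

/-- **`θ` on a type-III* Tate normal form with `E[3]` irreducible over `F`** (`‖a₁‖ ≤ ‖3‖`,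
`‖a₂‖ ≤ ‖3‖²`, `‖a₃‖, ‖a₄‖ ≤ ‖3‖³`, `‖a₆‖ ≤ ‖3‖⁵`, `‖Δ‖ = ‖3‖⁹`): there is `θ : E(F̄) → k`
additive and injective on `E[3]` with `ψ₂(σ)⁵ θ(σT) = θ(T)` on inertia (`θ(σT) = ψ₂(σ)³ θ(T)`).
Irreducibility forces `‖b₂‖ ≤ ‖3‖³` (`not_hasIrreducibleModPGaloisRep_three_of_algNorm_b₂_eq_IIIstar`),
whence `‖x‖⁴ = ‖3‖⁵`, `‖y‖⁸ = ‖3‖¹⁵` on `E[3] ∖ 0`, and `exists_additive_equivariant_of_torsion_norms`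
applies with `k = 3`.
[cite: SerreInventiones1972, §1.9 Prop. 9, §1.10, §1.11] [cite: ConradDiamondTaylor1999, §7.2, proof of Thm. 7.2.1 (p. 553)]
[cite: SilvermanATAEC1994, IV.9.4 Step 9 and Table 4.1 (type III*)] -/
theorem exists_additive_equivariant_of_tateNormalForm_IIIstar (hirr : Irreducible ((3 : ℕ) : 𝒪[F]))
    (hq : residueFieldCard F = 3)
    (h₁ : algNorm F (V.baseChange (AlgebraicClosure F)).a₁ ≤ algNorm F (3 : AlgebraicClosure F))
    (h₂ : algNorm F (V.baseChange (AlgebraicClosure F)).a₂ ≤ algNorm F (3 : AlgebraicClosure F) ^ 2)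
    (h₃ : algNorm F (V.baseChange (AlgebraicClosure F)).a₃ ≤ algNorm F (3 : AlgebraicClosure F) ^ 3)
    (h₄ : algNorm F (V.baseChange (AlgebraicClosure F)).a₄ ≤ algNorm F (3 : AlgebraicClosure F) ^ 3)
    (h₆ : algNorm F (V.baseChange (AlgebraicClosure F)).a₆ ≤ algNorm F (3 : AlgebraicClosure F) ^ 5)
    (hΔ : algNorm F (V.baseChange (AlgebraicClosure F)).Δ = algNorm F (3 : AlgebraicClosure F) ^ 9)
    (hIrr : V.HasIrreducibleModPGaloisRep 3)
    {k' : Type v} [Field k'] (ι : absIntegers 𝒪[F] F ⧸ absMaximalIdeal F →+* k') :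
    ∃ θ : geomPoints V → k',
      (∀ X ∈ geomTorsion V (3 : ℕ), ∀ Y ∈ geomTorsion V (3 : ℕ), θ (X + Y) = θ X + θ Y) ∧
      (∀ X ∈ geomTorsion V (3 : ℕ), θ X = 0 → X = 0) ∧
      (∀ (σ : absInertia F), ∀ X ∈ geomTorsion V (3 : ℕ),
        (fundamentalCharacter F 2 ι ((3 : ℕ) : 𝒪[F]) hirr σ : k') ^ 5 *
          θ ((σ : absoluteGaloisGroup F) • X) = θ X) := by
  obtain ⟨hq0, hq1⟩ := algNorm_three_pos_lt_one hirr
  set L := AlgebraicClosure F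
  set X := V.baseChange L with hX
  set q := algNorm F (3 : L) with hqdef
  have hqle : ∀ {m n : ℕ}, m ≤ n → q ^ n ≤ q ^ m := fun h ↦ pow_le_pow_of_le_one hq0.le hq1.le h
  have hqlt : ∀ {m n : ℕ}, m < n → q ^ n < q ^ m := fun h ↦ pow_lt_pow_right_of_lt_one₀ hq0 hq1 h
  obtain ⟨hb₂, hb₄, hb₆, hb₈⟩ := algNorm_b_of_tateNormalForm_IIIstar X hirr h₁ h₂ h₃ h₄ h₆ hΔ
  -- irreducibility: `‖b₂‖ ≤ q³`
  have hb₂' : algNorm F X.b₂ ≤ q ^ 3 := by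
    have hXb : X.b₂ = algebraMap F L V.b₂ := baseChange_b₂_eq V
    by_cases hb0 : V.b₂ = 0
    · rw [hXb, hb0, map_zero, algNorm_zero]; exact pow_nonneg hq0.le 3
    · obtain ⟨n, hn⟩ := exists_algNorm_algebraMap_eq_zpow hirr hb0
      rw [map_natCast, Nat.cast_ofNat, ← hXb] at hn
      exact algNorm_le_pow_succ_of_ne hirr hn hb₂ fun h1 ↦
        not_hasIrreducibleModPGaloisRep_three_of_algNorm_b₂_eq_IIIstar V hirr h1 hb₄ hb₆ hb₈ hIrr
  have hcoord : ∀ T ∈ geomTorsion V (3 : ℕ), ∀ {x y : L} {h : X.toAffine.Nonsingular x y},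
      (T : geomPoints V) = .some x y h →
        algNorm F x ^ 4 = q ^ (2 * 3 - 1) ∧ algNorm F y ^ 8 = q ^ (6 * 3 - 3) := by
    intro T hT x y h hTc
    have hΨ : X.Ψ₃.eval x = 0 :=
      V.eval_divisionPolynomial_three_eq_zero_of_eq_some (T := ⟨T, hT⟩) hTc
    have hx : algNorm F x ^ 4 = q ^ 5 :=
      algNorm_root_Ψ₃_pow_four_IIIstar X hirr hb₂' hb₄.le hb₆ hb₈ hΨ
    have hx8 : algNorm F x ^ 8 = q ^ 10 := by
      rw [show (8 : ℕ) = 4 * 2 from rfl, pow_mul, hx, ← pow_mul]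
    have ha₁x : algNorm F (X.a₁ * x) ^ 8 < q ^ 15 := by
      rw [algNorm_mul, mul_pow, hx8]
      calc algNorm F X.a₁ ^ 8 * q ^ 10 ≤ q ^ 8 * q ^ 10 :=
            mul_le_mul_of_nonneg_right (pow_le_pow_left₀ (algNorm_nonneg _) h₁ 8) (pow_nonneg hq0.le 10)
        _ = q ^ 18 := by ring
        _ < q ^ 15 := hqlt (by norm_num)
    have ha₃' : algNorm F X.a₃ ^ 8 < q ^ 15 := by
      calc algNorm F X.a₃ ^ 8 ≤ (q ^ 3) ^ 8 := pow_le_pow_left₀ (algNorm_nonneg _) h₃ 8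
        _ = q ^ 24 := by ring
        _ < q ^ 15 := hqlt (by norm_num)
    have hy := algNorm_y_pow_eight_eq X hirr h.left
      (algNorm_eval_Ψ₂Sq_pow_four_IIIstar X hirr hb₂' hb₄.le hb₆ hx) ha₁x ha₃'
    exact ⟨hx, hy⟩
  have g₁ : algNorm F X.a₁ ^ 4 ≤ q ^ 3 :=
    (pow_le_pow_left₀ (algNorm_nonneg _) h₁ 4).trans (hqle (show 3 ≤ 4 by norm_num))
  have g₂ : algNorm F X.a₂ ^ 2 ≤ q ^ 3 :=
    (pow_le_pow_left₀ (algNorm_nonneg _) h₂ 2).trans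
      (by rw [← pow_mul]; exact hqle (show 3 ≤ 2 * 2 by norm_num))
  have g₃ : algNorm F X.a₃ ^ 4 ≤ q ^ (3 * 3) :=
    (pow_le_pow_left₀ (algNorm_nonneg _) h₃ 4).trans
      (by rw [← pow_mul]; exact hqle (show 3 * 3 ≤ 3 * 4 by norm_num))
  have g₆ : algNorm F X.a₆ ^ 2 ≤ q ^ (3 * 3) :=
    (pow_le_pow_left₀ (algNorm_nonneg _) h₆ 2).trans
      (by rw [← pow_mul]; exact hqle (show 3 * 3 ≤ 5 * 2 by norm_num))
  obtain ⟨θ, hadd, hinj, hsmul⟩ := exists_additive_equivariant_of_torsion_norms hirr hq V 3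
    (by norm_num) g₁ g₂ g₃ h₄ g₆ hcoord ι
  exact ⟨θ, hadd, hinj, fun σ T hT ↦ hsmul σ T hT⟩

end Wrappers

/-! ### The level-two inertia shapes `(1, 2)` and `(0, 1)` -/

section Shapes

/-- `ψ₂⁸ = 1` pointwise when `#k_F = 3`. [cite: SerreInventiones1972, §1.7] -/
private theorem fundamentalCharacter_two_pow_eight (hirr : Irreducible ((3 : ℕ) : 𝒪[F]))
    (hq : residueFieldCard F = 3) {k : Type v} [Field k]
    (ι : absIntegers 𝒪[F] F ⧸ absMaximalIdeal F →+* k) (σ : absInertia F) :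
    ((fundamentalCharacter F 2 ι ((3 : ℕ) : 𝒪[F]) hirr σ : kˣ) : k) ^ 8 = 1 := by
  have h := InertiaShape.fundamentalCharacter_pow_eq_one (F := F) (k := k) (m := 2) two_ne_zero ι
    ((3 : ℕ) : 𝒪[F]) hirr
  have h' := congrArg (fun χ : absInertia F →* kˣ ↦ ((χ σ : kˣ) : k)) h
  simp only [MonoidHom.pow_apply, Units.val_pow_eq_pow_val, MonoidHom.one_apply, Units.val_one,
    hq] at h'
  norm_num at h'
  exact h'

variable [CharZero F] (V : WeierstrassCurve F) [V.IsElliptic]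

/-- **Shape `(1, 2)` on the irreducible type-III rows.**  For a type-III Tate normal form `E/F`
(`F` a `3`-adic field with uniformiser `3` and residue field `𝔽₃`) with `E[3]` irreducible over
`F`, and any framing `ρ̄` of `E[3]` with scalars extended along `j : 𝔽₃ → k`:
`ρ̄ ⊗ k |_{I_F} ≃ diag(ψ₂⁷, ψ₂⁵) = diag(ψ₂^{1+3·2}, ψ₂^{3·1+2})`.  (From
`exists_additive_equivariant_of_tateNormalForm_III`: `θ³` is additive, injective and
`ψ₂^{21} = ψ₂⁵`-equivariant; `hasLevelTwoInertiaShape_of_additive_equivariant_exponent_local`.)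
[cite: SerreInventiones1972, §1.11 Prop. 12 and Cor.] [cite: Serre1987, §2.2]
[cite: ConradDiamondTaylor1999, §7.2, proof of Thm. 7.2.1 (p. 553)] -/
theorem hasLevelTwoInertiaShape_one_two_of_tateNormalForm_III
    (hirr : Irreducible ((3 : ℕ) : 𝒪[F])) (hq : residueFieldCard F = 3)
    (h₁ : algNorm F (V.baseChange (AlgebraicClosure F)).a₁ ≤ algNorm F (3 : AlgebraicClosure F))
    (h₂ : algNorm F (V.baseChange (AlgebraicClosure F)).a₂ ≤ algNorm F (3 : AlgebraicClosure F))
    (h₃ : algNorm F (V.baseChange (AlgebraicClosure F)).a₃ ≤ algNorm F (3 : AlgebraicClosure F))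
    (h₄ : algNorm F (V.baseChange (AlgebraicClosure F)).a₄ ≤ algNorm F (3 : AlgebraicClosure F))
    (h₆ : algNorm F (V.baseChange (AlgebraicClosure F)).a₆ ≤ algNorm F (3 : AlgebraicClosure F) ^ 2)
    (hΔ : algNorm F (V.baseChange (AlgebraicClosure F)).Δ = algNorm F (3 : AlgebraicClosure F) ^ 3)
    (hIrr : V.HasIrreducibleModPGaloisRep 3)
    {ρ : ModPGaloisRep F (ZMod 3) 2} (hρ : V.IsTorsionGaloisRep 3 ρ)
    {k : Type} [Field k] [TopologicalSpace k] (j : ZMod 3 →+* k) (hj : Continuous j)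
    (ι : absIntegers 𝒪[F] F ⧸ absMaximalIdeal F →+* k) :
    ModPGaloisRep.HasLevelTwoInertiaShape (FramedRep.baseChange j hj ρ : ModPGaloisRep F k 2) ι
      ((3 : ℕ) : 𝒪[F]) hirr 1 2 := by
  haveI : Fact (Nat.Prime 3) := ⟨Nat.prime_three⟩
  haveI : CharP k 3 := charP_of_injective_ringHom j.injective 3
  have hone := fundamentalCharacter_two_pow_eight hirr hq ι
  obtain ⟨θ, hadd, hinj, hsmul⟩ :=
    exists_additive_equivariant_of_tateNormalForm_III V hirr hq h₁ h₂ h₃ h₄ h₆ hΔ hIrr ι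
  -- `θ(σX) = ψ₂(σ)⁷ θ(X)`
  have hsmul7 : ∀ (σ : absInertia F), ∀ X ∈ geomTorsion V (3 : ℕ),
      θ ((σ : absoluteGaloisGroup F) • X) =
        ((fundamentalCharacter F 2 ι ((3 : ℕ) : 𝒪[F]) hirr σ : kˣ) : k) ^ 7 * θ X := by
    intro σ X hX
    rw [← hsmul σ X hX, ← mul_assoc, ← pow_succ, hone σ, one_mul]
  refine hρ.hasLevelTwoInertiaShape_of_additive_equivariant_exponent_local j hj hirr ι hq
    (fun X ↦ θ X ^ 3) 5 1 2 ?_ ?_ ?_ ?_ ?_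
  · intro X hX Y hY
    rw [hadd X hX Y hY]
    exact add_pow_char (θ X) (θ Y) 3
  · intro X hX h0
    exact hinj X hX (pow_eq_zero_iff three_ne_zero |>.mp h0)
  · intro σ X hX
    rw [hsmul7 σ X hX, mul_pow, ← pow_mul,
      show 7 * 3 = 8 * 2 + 5 by norm_num, pow_add, pow_mul, hone σ, one_pow, one_mul]
  · intro σ
    rw [show 5 * 3 = 8 + (1 + 3 * 2) by norm_num, pow_add, hone σ, one_mul]
  · intro σ
    norm_num

/-- **Shape `(0, 1)` on the irreducible type-III* rows.**  For a type-III* Tate normal form `E/F`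
with `E[3]` irreducible over `F` and any framing `ρ̄` of `E[3]`, `j : 𝔽₃ → k`:
`ρ̄ ⊗ k |_{I_F} ≃ diag(ψ₂³, ψ₂) = diag(ψ₂^{0+3·1}, ψ₂^{3·0+1})` (`θ³` from
`exists_additive_equivariant_of_tateNormalForm_IIIstar` is `ψ₂⁹ = ψ₂`-equivariant).
[cite: SerreInventiones1972, §1.11 Prop. 12 and Cor.] [cite: Serre1987, §2.2]
[cite: ConradDiamondTaylor1999, §7.2, proof of Thm. 7.2.1 (p. 553)] -/
theorem hasLevelTwoInertiaShape_zero_one_of_tateNormalForm_IIIstar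
    (hirr : Irreducible ((3 : ℕ) : 𝒪[F])) (hq : residueFieldCard F = 3)
    (h₁ : algNorm F (V.baseChange (AlgebraicClosure F)).a₁ ≤ algNorm F (3 : AlgebraicClosure F))
    (h₂ : algNorm F (V.baseChange (AlgebraicClosure F)).a₂ ≤ algNorm F (3 : AlgebraicClosure F) ^ 2)
    (h₃ : algNorm F (V.baseChange (AlgebraicClosure F)).a₃ ≤ algNorm F (3 : AlgebraicClosure F) ^ 3)
    (h₄ : algNorm F (V.baseChange (AlgebraicClosure F)).a₄ ≤ algNorm F (3 : AlgebraicClosure F) ^ 3)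
    (h₆ : algNorm F (V.baseChange (AlgebraicClosure F)).a₆ ≤ algNorm F (3 : AlgebraicClosure F) ^ 5)
    (hΔ : algNorm F (V.baseChange (AlgebraicClosure F)).Δ = algNorm F (3 : AlgebraicClosure F) ^ 9)
    (hIrr : V.HasIrreducibleModPGaloisRep 3)
    {ρ : ModPGaloisRep F (ZMod 3) 2} (hρ : V.IsTorsionGaloisRep 3 ρ)
    {k : Type} [Field k] [TopologicalSpace k] (j : ZMod 3 →+* k) (hj : Continuous j)
    (ι : absIntegers 𝒪[F] F ⧸ absMaximalIdeal F →+* k) :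
    ModPGaloisRep.HasLevelTwoInertiaShape (FramedRep.baseChange j hj ρ : ModPGaloisRep F k 2) ι
      ((3 : ℕ) : 𝒪[F]) hirr 0 1 := by
  haveI : Fact (Nat.Prime 3) := ⟨Nat.prime_three⟩
  haveI : CharP k 3 := charP_of_injective_ringHom j.injective 3
  have hone := fundamentalCharacter_two_pow_eight hirr hq ι
  obtain ⟨θ, hadd, hinj, hsmul⟩ :=
    exists_additive_equivariant_of_tateNormalForm_IIIstar V hirr hq h₁ h₂ h₃ h₄ h₆ hΔ hIrr ι
  -- `θ(σX) = ψ₂(σ)³ θ(X)`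
  have hsmul3 : ∀ (σ : absInertia F), ∀ X ∈ geomTorsion V (3 : ℕ),
      θ ((σ : absoluteGaloisGroup F) • X) =
        ((fundamentalCharacter F 2 ι ((3 : ℕ) : 𝒪[F]) hirr σ : kˣ) : k) ^ 3 * θ X := by
    intro σ X hX
    rw [← hsmul σ X hX, ← mul_assoc, ← pow_add, show 3 + 5 = 8 by norm_num, hone σ, one_mul]
  refine hρ.hasLevelTwoInertiaShape_of_additive_equivariant_exponent_local j hj hirr ι hq
    (fun X ↦ θ X ^ 3) 1 0 1 ?_ ?_ ?_ ?_ ?_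
  · intro X hX Y hY
    rw [hadd X hX Y hY]
    exact add_pow_char (θ X) (θ Y) 3
  · intro X hX h0
    exact hinj X hX (pow_eq_zero_iff three_ne_zero |>.mp h0)
  · intro σ X hX
    rw [hsmul3 σ X hX, mul_pow, ← pow_mul,
      show 3 * 3 = 8 + 1 by norm_num, pow_add, hone σ, one_mul]
  · intro σ
    norm_num
  · intro σ
    norm_num

end Shapes

end Literature.NumberTheory.EllipticCurves.ThreeTorsionIrreducibleShape

/-! ## §6. Over `ℚ`: Serre's weight at every local restriction datum over `3` -/

namespace Literature.NumberTheory.EllipticCurves.ThreeTorsionIrreducibleShape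

open Literature.NumberTheory.GaloisRepresentations
  Literature.NumberTheory.GaloisRepresentations.IsNonarchimedeanLocalField
  Literature.NumberTheory.GaloisRepresentations.ModPGaloisRep
  Literature.NumberTheory.EllipticCurves.ThreeTorsionReducibleShape _root_.WeierstrassCurve
  Rat.HeightOneSpectrum IsDedekindDomain

section Rat

/-- **Serre weight SIX on the irreducible type-III rows at `3`.**  Let `E/ℚ` be elliptic with
Kodaira type III at the place `v` over `3`, `ρ̄` a framing of `E[3]`, `j : 𝔽₃ → k` into a discrete
field, `loc` ANY local restriction datum of `ρ̄ ⊗_j k` at `3` (`loc.F ≅ ℚ₃`) and `ι` a residue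
embedding.  If `E[3]` is IRREDUCIBLE as a `Γ_{loc.F}`-module then `k(ρ̄ ⊗ k) = 6`:
`ρ̄|I ≃ diag(ψ₂^{1+3·2}, ψ₂^{3·1+2})` on the rational type-III Tate normal form
(`hasLevelTwoInertiaShape_one_two_of_tateNormalForm_III`), whence `k = 1 + 3·1 + 2 = 6`
(`serreWeight_eq_of_hasLevelTwoInertiaShape`).  This is the sub-case "`ρ̄|G₃ ≅ E[3](ℚ̄₃)`
irreducible, `ρ̄|I₃ = ψ₂^{?} ⊕ ψ₂^{3·?}` of level `2`" of Conrad–Diamond–Taylor, proof of Thm. 7.2.1.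
[cite: ConradDiamondTaylor1999, §7.2, proof of Thm. 7.2.1 (p. 553) and Conj. 1.2.3 (p. 525)]
[cite: Serre1987, §2.2 (2.2.4)] [cite: SerreInventiones1972, §1.11 Prop. 12]
[cite: SilvermanATAEC1994, IV.9.4 Table 4.1 (type III)] -/
theorem serreWeight_three_eq_six_of_kodairaSymbolAt_III_of_hasIrreducibleModPGaloisRep
    (W : WeierstrassCurve ℚ) [W.IsElliptic]
    (v : HeightOneSpectrum ℤ) (hv : ((primesEquiv (R := ℤ) v : Nat.Primes) : ℕ) = 3)
    (hK : W.kodairaSymbolAt v = .III)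
    {ρ : ModPGaloisRep ℚ (ZMod 3) 2} (hρ : W.IsTorsionGaloisRep 3 ρ)
    {k : Type} [Field k] [TopologicalSpace k] [DiscreteTopology k] (j : ZMod 3 →+* k)
    (hj : Continuous j) (loc : ModPGaloisRep.LocalRestrictionAt 3 (FramedRep.baseChange j hj ρ))
    (ι : absIntegers 𝒪[loc.F] loc.F ⧸ absMaximalIdeal loc.F →+* k)
    (hIrr : (W.baseChange loc.F).HasIrreducibleModPGaloisRep 3) :
    ModPGaloisRep.serreWeight 3 (FramedRep.baseChange j hj ρ) loc ι = 6 := by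
  classical
  set F := loc.F
  haveI : CharZero F := charZero_of_injective_algebraMap (algebraMap ℚ F).injective
  haveI : Fact (Nat.Prime 3) := ⟨Nat.prime_three⟩
  have hirr : Irreducible ((3 : ℕ) : 𝒪[F]) := loc.irreducible_natCast
  have hq : residueFieldCard F = 3 := loc.residueFieldCard_eq
  haveI : PerfectField (IsLocalRing.ResidueField (v.adicCompletionIntegers ℚ)) := PerfectField.ofFinite
  have h2 : ringChar (ℤ ⧸ v.asIdeal) ≠ 2 := by
    rw [Rat.ringChar_int_quotient_asIdeal v, show natGenerator v = 3 from hv]; decide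
  obtain ⟨C, c₁, c₂, c₃, c₄, c₆, cΔ⟩ := W.exists_variableChange_tateNormalForm_III v h2 hK
  set V : WeierstrassCurve F := (C • W).baseChange F with hV
  have hρF : (W.baseChange F).IsTorsionGaloisRep 3 (FramedGaloisRep.restrictField F ρ) :=
    hρ.restrictField three_ne_zero F
  have hρV : V.IsTorsionGaloisRep 3 (FramedGaloisRep.restrictField F ρ) := by
    rw [hV, baseChange_smul_eq]; exact isTorsionGaloisRep_variableChange' _ _ hρF
  have hIrrV : V.HasIrreducibleModPGaloisRep 3 := by
    rw [hV, baseChange_smul_eq]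
    exact (Mazur1978.hasIrreducibleModPGaloisRep_smul_iff _ _ 3).mpr hIrr
  have n₁ := algNorm_le_pow_of_valuation_le v hv hirr 1 (a := (C • W).a₁) (by simpa using c₁)
  have n₂ := algNorm_le_pow_of_valuation_le v hv hirr 1 (a := (C • W).a₂) (by simpa using c₂)
  have n₃ := algNorm_le_pow_of_valuation_le v hv hirr 1 (a := (C • W).a₃) (by simpa using c₃)
  have n₄ := algNorm_le_pow_of_valuation_le v hv hirr 1 (a := (C • W).a₄) (by simpa using c₄)
  have n₆ := algNorm_le_pow_of_valuation_le v hv hirr 2 (a := (C • W).a₆) (by simpa using c₆)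
  have nΔ := algNorm_eq_pow_of_valuation_eq v hv hirr 3 (a := (C • W).Δ) (by simpa using cΔ)
  rw [pow_one] at n₁ n₂ n₃ n₄
  have hVΔ : (V.baseChange (AlgebraicClosure F)).Δ =
      algebraMap F (AlgebraicClosure F) (algebraMap ℚ F (C • W).Δ) := by
    rw [hV, WeierstrassCurve.baseChange, WeierstrassCurve.baseChange, map_Δ, map_Δ]
  have hshape := hasLevelTwoInertiaShape_one_two_of_tateNormalForm_III V hirr hq n₁ n₂ n₃ n₄ n₆
    (by rw [hVΔ]; exact nΔ) hIrrV hρV j hj ι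
  have hrep : loc.rep = FramedRep.baseChange j hj (FramedGaloisRep.restrictField F ρ) := by
    rw [loc.rep_eq_restrictField]; exact DFunLike.ext _ _ fun _ ↦ rfl
  have h := serreWeight_eq_of_hasLevelTwoInertiaShape loc ι (a := 1) (b := 2) (by norm_num)
    (by norm_num) (by rw [hrep]; exact hshape)
  simpa using h

/-- **Serre weight TWO on the irreducible type-III* rows at `3`.**  For `E/ℚ` elliptic of Kodaira
type III* at the place `v` over `3`, a framing `ρ̄` of `E[3]`, `j : 𝔽₃ → k`, `loc` ANY local
restriction datum of `ρ̄ ⊗_j k` at `3` and `ι` a residue embedding: if `E[3]` is IRREDUCIBLE as a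
`Γ_{loc.F}`-module then `k(ρ̄ ⊗ k) = 2` (`ρ̄|I ≃ diag(ψ₂^{0+3·1}, ψ₂^{3·0+1})` on the rational
type-III* Tate normal form, `hasLevelTwoInertiaShape_zero_one_of_tateNormalForm_IIIstar`;
`k = 1 + 3·0 + 1 = 2`).
[cite: ConradDiamondTaylor1999, §7.2, proof of Thm. 7.2.1 (p. 553)] [cite: Serre1987, §2.2 (2.2.4)]
[cite: SerreInventiones1972, §1.11 Prop. 12] [cite: SilvermanATAEC1994, IV.9.4 Table 4.1 (type III*)] -/
theorem serreWeight_three_eq_two_of_kodairaSymbolAt_IIIstar_of_hasIrreducibleModPGaloisRep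
    (W : WeierstrassCurve ℚ) [W.IsElliptic]
    (v : HeightOneSpectrum ℤ) (hv : ((primesEquiv (R := ℤ) v : Nat.Primes) : ℕ) = 3)
    (hK : W.kodairaSymbolAt v = .IIIstar)
    {ρ : ModPGaloisRep ℚ (ZMod 3) 2} (hρ : W.IsTorsionGaloisRep 3 ρ)
    {k : Type} [Field k] [TopologicalSpace k] [DiscreteTopology k] (j : ZMod 3 →+* k)
    (hj : Continuous j) (loc : ModPGaloisRep.LocalRestrictionAt 3 (FramedRep.baseChange j hj ρ))
    (ι : absIntegers 𝒪[loc.F] loc.F ⧸ absMaximalIdeal loc.F →+* k)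
    (hIrr : (W.baseChange loc.F).HasIrreducibleModPGaloisRep 3) :
    ModPGaloisRep.serreWeight 3 (FramedRep.baseChange j hj ρ) loc ι = 2 := by
  classical
  set F := loc.F
  haveI : CharZero F := charZero_of_injective_algebraMap (algebraMap ℚ F).injective
  haveI : Fact (Nat.Prime 3) := ⟨Nat.prime_three⟩
  have hirr : Irreducible ((3 : ℕ) : 𝒪[F]) := loc.irreducible_natCast
  have hq : residueFieldCard F = 3 := loc.residueFieldCard_eq
  haveI : PerfectField (IsLocalRing.ResidueField (v.adicCompletionIntegers ℚ)) := PerfectField.ofFinite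
  have h2 : ringChar (ℤ ⧸ v.asIdeal) ≠ 2 := by
    rw [Rat.ringChar_int_quotient_asIdeal v, show natGenerator v = 3 from hv]; decide
  obtain ⟨C, c₁, c₂, c₃, c₄, c₆, cΔ⟩ := W.exists_variableChange_tateNormalForm_IIIstar v h2 hK
  set V : WeierstrassCurve F := (C • W).baseChange F with hV
  have hρF : (W.baseChange F).IsTorsionGaloisRep 3 (FramedGaloisRep.restrictField F ρ) :=
    hρ.restrictField three_ne_zero F
  have hρV : V.IsTorsionGaloisRep 3 (FramedGaloisRep.restrictField F ρ) := by
    rw [hV, baseChange_smul_eq]; exact isTorsionGaloisRep_variableChange' _ _ hρF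
  have hIrrV : V.HasIrreducibleModPGaloisRep 3 := by
    rw [hV, baseChange_smul_eq]
    exact (Mazur1978.hasIrreducibleModPGaloisRep_smul_iff _ _ 3).mpr hIrr
  have n₁ := algNorm_le_pow_of_valuation_le v hv hirr 1 (a := (C • W).a₁) (by simpa using c₁)
  have n₂ := algNorm_le_pow_of_valuation_le v hv hirr 2 (a := (C • W).a₂) (by simpa using c₂)
  have n₃ := algNorm_le_pow_of_valuation_le v hv hirr 3 (a := (C • W).a₃) (by simpa using c₃)
  have n₄ := algNorm_le_pow_of_valuation_le v hv hirr 3 (a := (C • W).a₄) (by simpa using c₄)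
  have n₆ := algNorm_le_pow_of_valuation_le v hv hirr 5 (a := (C • W).a₆) (by simpa using c₆)
  have nΔ := algNorm_eq_pow_of_valuation_eq v hv hirr 9 (a := (C • W).Δ) (by simpa using cΔ)
  rw [pow_one] at n₁
  have hVΔ : (V.baseChange (AlgebraicClosure F)).Δ =
      algebraMap F (AlgebraicClosure F) (algebraMap ℚ F (C • W).Δ) := by
    rw [hV, WeierstrassCurve.baseChange, WeierstrassCurve.baseChange, map_Δ, map_Δ]
  have hshape := hasLevelTwoInertiaShape_zero_one_of_tateNormalForm_IIIstar V hirr hq n₁ n₂ n₃ n₄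
    n₆ (by rw [hVΔ]; exact nΔ) hIrrV hρV j hj ι
  have hrep : loc.rep = FramedRep.baseChange j hj (FramedGaloisRep.restrictField F ρ) := by
    rw [loc.rep_eq_restrictField]; exact DFunLike.ext _ _ fun _ ↦ rfl
  have h := serreWeight_eq_of_hasLevelTwoInertiaShape loc ι (a := 0) (b := 1) (by norm_num)
    (by norm_num) (by rw [hrep]; exact hshape)
  simpa using h

/-- **Serre weight SIX on ALL type-III rows at `3`, at every local restriction datum.**  For
`E/ℚ` elliptic with Kodaira type III at the place over `3` (e.g. the `(t′)` curves of the tame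
quartic class with `v₃(Δ_min) = 3`), any framing `ρ̄` of `E[3]`, `j : 𝔽₃ → k` into a discrete
field, ANY `loc` and `ι`: `k(ρ̄ ⊗_j k) = 6` — by cases on the reducibility of `E[3]` over
`loc.F ≅ ℚ₃` (reducible: wild, shape `(1 *; 0 χ̄₃)`, peu ramifié,
`serreWeight_three_eq_six_of_kodairaSymbolAt_III_of_not_hasIrreducibleModPGaloisRep`;
irreducible: tame of level `2`, `diag(ψ₂⁷, ψ₂⁵)`, this file).  Both branches of
Conrad–Diamond–Taylor's dichotomy `k ∈ {2, 6}` for conductor `27` thus give `6` on type III.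
[cite: ConradDiamondTaylor1999, §7.2, proof of Thm. 7.2.1 (p. 553) and Conj. 1.2.3 (p. 525)]
[cite: Serre1987, §2.2 (2.2.4), §2.4 (2.4.8)] -/
theorem serreWeight_three_eq_six_of_kodairaSymbolAt_III (W : WeierstrassCurve ℚ) [W.IsElliptic]
    (v : HeightOneSpectrum ℤ) (hv : ((primesEquiv (R := ℤ) v : Nat.Primes) : ℕ) = 3)
    (hK : W.kodairaSymbolAt v = .III)
    {ρ : ModPGaloisRep ℚ (ZMod 3) 2} (hρ : W.IsTorsionGaloisRep 3 ρ)
    {k : Type} [Field k] [TopologicalSpace k] [DiscreteTopology k] (j : ZMod 3 →+* k)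
    (hj : Continuous j) (loc : ModPGaloisRep.LocalRestrictionAt 3 (FramedRep.baseChange j hj ρ))
    (ι : absIntegers 𝒪[loc.F] loc.F ⧸ absMaximalIdeal loc.F →+* k) :
    ModPGaloisRep.serreWeight 3 (FramedRep.baseChange j hj ρ) loc ι = 6 := by
  by_cases hIrr : (W.baseChange loc.F).HasIrreducibleModPGaloisRep 3
  · exact serreWeight_three_eq_six_of_kodairaSymbolAt_III_of_hasIrreducibleModPGaloisRep W v hv hK
      hρ j hj loc ι hIrr
  · exact serreWeight_three_eq_six_of_kodairaSymbolAt_III_of_not_hasIrreducibleModPGaloisRep W v hv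
      hK hρ j hj loc ι hIrr

/-- **Serre weight TWO on ALL type-III* rows at `3`, at every local restriction datum** (by
cases on the reducibility of `E[3]` over `loc.F`: reducible `(χ̄₃ *; 0 1)` peu ramifié,
`serreWeight_three_eq_two_of_kodairaSymbolAt_IIIstar_of_not_hasIrreducibleModPGaloisRep`;
irreducible `diag(ψ₂³, ψ₂)`, this file).
[cite: ConradDiamondTaylor1999, §7.2, proof of Thm. 7.2.1 (p. 553)]
[cite: Serre1987, §2.2 (2.2.4), §2.8 (2.8.2)] -/
theorem serreWeight_three_eq_two_of_kodairaSymbolAt_IIIstar (W : WeierstrassCurve ℚ) [W.IsElliptic]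
    (v : HeightOneSpectrum ℤ) (hv : ((primesEquiv (R := ℤ) v : Nat.Primes) : ℕ) = 3)
    (hK : W.kodairaSymbolAt v = .IIIstar)
    {ρ : ModPGaloisRep ℚ (ZMod 3) 2} (hρ : W.IsTorsionGaloisRep 3 ρ)
    {k : Type} [Field k] [TopologicalSpace k] [DiscreteTopology k] (j : ZMod 3 →+* k)
    (hj : Continuous j) (loc : ModPGaloisRep.LocalRestrictionAt 3 (FramedRep.baseChange j hj ρ))
    (ι : absIntegers 𝒪[loc.F] loc.F ⧸ absMaximalIdeal loc.F →+* k) :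
    ModPGaloisRep.serreWeight 3 (FramedRep.baseChange j hj ρ) loc ι = 2 := by
  by_cases hIrr : (W.baseChange loc.F).HasIrreducibleModPGaloisRep 3
  · exact serreWeight_three_eq_two_of_kodairaSymbolAt_IIIstar_of_hasIrreducibleModPGaloisRep W v hv
      hK hρ j hj loc ι hIrr
  · exact serreWeight_three_eq_two_of_kodairaSymbolAt_IIIstar_of_not_hasIrreducibleModPGaloisRep W
      v hv hK hρ j hj loc ι hIrr

end Rat

end Literature.NumberTheory.EllipticCurves.ThreeTorsionIrreducibleShape


end
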